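import Literature.MathematicalPhysics.QuantumFieldTheory.Balaban1983to89.B9Ineq361L2Letters
import Literature.MathematicalPhysics.QuantumFieldTheory.Balaban1983to89.B9Eq382V3Letters

/-!
# `Balaban1983to89.B9Ineq373L2Letters` — [Balaban1985BackgroundPropagators] (3.73) p. 405 / (3.82) p. 407: THE LETTERS OF THE LOCAL FIRST-ORDER
# OPERATOR `V₃(A) = V₁(A) − (Δ′(U′U) − Δ′(U)) + V₂(A)` IN THE BLOCK-`ℓ²` CURRENCY OF (3.46) — the `ℓ²` twins of r06's sup-majorants of the
# bracket letters of (3.71) (`B9Eq371GradLetters`), of (3.75) (`B9Eq375GradLetters`), of the remainders `F₁`, `F₂` (3.72) (`B9Eq372RemLetters`) and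
# of the curvature third (`B9Eq382V3Letters`), with the SAME pointwise stencil bounds and ONE multiplicity count for all bond stencils; first brick of
# the kernel-free `ℓ²` route to the (3.46) members of Theorem 3.3's operator `G(U′U)` displayed in `B9SectBStepFrameV4.SectBFrame₄`

T. Bałaban, *Propagators for lattice gauge theories in a background field*, Commun. Math. Phys. **99** (1985) 389–434
[`Balaban1985BackgroundPropagators`, "B9"]; [4] = T. Bałaban, *Propagators and renormalization transformations for lattice gauge theories. II*,
Commun. Math. Phys. **96** (1984) 223–250 [`Balaban1984PropagatorsII`].

statement-level skeleton of published theorems with citation tags; proofs where landed; nothing here is a claim about the Yang–Mills mass gap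

THE PRINTED LOCUS (verbatim).  p. 405: *"the operators F_{2,k}(A), V₂(A) satisfy the bounds (3.72), (3.73) correspondingly"*, (3.73): *"|V₂(A)A′| ≤
O(1)(α₁(Lʲη)⁻²|A′| + α₁(Lʲη)⁻¹|∇_UA′|)"* (and the same for `V₁(A)`, (3.71)–(3.73) p. 404–405); p. 407: *"Δ_a(U′U) = Δ_a(U) − V₃(A) − P₁(A) − P₂(A). (3.82)
The operator V₃(A) is a local differential operator of the first order satisfying the bound (3.73)"*; *"Using the bounds (3.73), (3.77), (3.83) and
assuming that Theorem 3.3 holds for G(U), we get |(V(A)G(U)J)(b)| ≤ O(1)α₁e^{−(1/2)δ₀d(y,y′)}|J| … (3.85) … Theorem (3.3) implies also convergence in all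
norms appearing in its formulation, thus in all norms on the left-hand sides of the inequalities (3.42)–(3.47)"*; [4] Prop. 2.6 (2.140) p. 247 (the `L²`
block norms).

WHY THIS FILE (pub-ymgap N06 row 13, seat dag-n06-c g5).  After `B9SectBStepFrameV4` all six (3.46) member-steps of G′(U′U) are theorems on the letters;
the six members of G(U′U) (and (3.43)–(3.45) of G(U′U)) are still DISPLAYED, because the only route in the tree (r06's `B9Thm34GUniformR1` →
`B9Ineq346L2Final`) consumes Theorem 3.3 in the unprinted KERNEL form.  Print's own route is the sup bound (3.85) summed «in the norms appearing» — for
the `L²` members this needs (3.85) IN THE BLOCK-`ℓ²` FORM, i.e. block-`ℓ²` majorants of `V₃(A)·G(U)`, `P₁(A)·G(U)`, `P₂(A)·G(U)` from the `L²` members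
of Theorem 3.3 at U.  THIS FILE is the first brick: the `ℓ²` sizes of ALL the local letters of `V₃(A)` (the sequel `B9Ineq385L2V3` composes them with
Theorem 3.3's `L²` members by the generic device `B9Ineq363L2.ineq363_op_sum_l2`).  Every lemma is the `ℓ²` twin of an r06 sup lemma with the SAME
hypotheses plus finiteness of the carrier: the pointwise stencil bound is r06's verbatim, the seam is `B9Ineq361L2Letters.hasL2Majorant_conj_of_local`
(this seat, g4) instead of `B9Eq352DivFormLetters.hasMajorant_conj_of_local`, and the one new ingredient is the MULTIPLICITY of the bond stencils
(how many output bonds read a given input bond), counted once for all stencils of the programme (§0).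

WHAT IS PROVED (theorems only; 0 sorry; standard axioms; no new definition).
* §0 `mult_bond_of_shapes` — every bond stencil of r06's letters (the point itself, forward ∕ backward neighbours, forward-backward and backward-forward
  second neighbours) has multiplicity `≦ |κ|·(1 + 2|κ| + 2|κ|²)` (classical covering finsets through the translation group); `stBonds_shape`,
  `locBondsA'_shape` (the plaquette star of (3.72) and the (3.75)-stencil are of these shapes).
* §1 the bracket letters of `V₁(A)` (3.71) in `ℓ²`: `hasL2Majorant_coefLetter_bond`, `hasL2Majorant_mixLetterB`, `hasL2Majorant_zeroLetter`,
  `hasL2Majorant_mixLetterF`, ★ `hasL2Majorant_V1Letter` (twins of `B9Eq371GradLetters.hasMajorant_*`).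
* §2 the bracket letters of `V₂(A)` (3.75) in `ℓ²`: `hasL2Majorant_mixLetterB₂`, `hasL2Majorant_zeroLetter₂`, `hasL2Majorant_mixLetterF₂`,
  ★ `hasL2Majorant_V1Letter₂` (twins of `B9Eq375GradLetters.hasMajorant_*`).
* §3 the remainders and the curvature third in `ℓ²`: `hasL2Majorant_F₁Letter`, `hasL2Majorant_F₂Letter` ((3.72)), `hasL2Majorant_V₁Op_zero`,
  `hasL2Majorant_dPrimeDiff` (twins of `B9Eq372RemLetters.hasMajorant_*`, `B9Eq382V3Letters.hasMajorant_dPrimeDiff`).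
* §4 ★★ `hasL2Majorant_V₃_one`, ★★ `hasL2Majorant_V₃_zero` — the `hV1` ∕ `hV0` inputs of `ineq363_op_sum_l2` for the concrete `V₃(A)` of (3.82) along
  r06's `conj_V₃Op_eq_gradForm` (twins of `B9Eq382V3Letters.hasMajorant_V₃_one` ∕ `hasMajorant_V₃_zero`, same constants times `√(N·#ι)`).

HONEST SCOPE.  Finite-dimensional bookkeeping over r06's concrete letters; the exponent field `A` and the background `U` are binders with the (3.35) ∕
(3.37) readings as hypotheses, exactly as in the sup programme; nothing of [B9] is asserted for Bałaban's propagators; count-neutral; NOT a node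
discharge; nothing continuum ∕ OS ∕ mass-gap ∕ Clay.  Cell `pub-ymgap` (HUMAN RULING D-0062), Track A node N06 [B9], N06-ASSIGNMENT row 13 (the displayed
`L²` steps of G), seat `pub-ymgap-dag-n06-c` (g5), 2026-08-27.

RELATED IN THE TREE, NOT DUPLICATED: the sup twins named above (used for their pointwise cores BY NAME where those are separate lemmas:
`B9Eq372Locality.norm_F₁op_le_st`, `B9Eq375Locality.norm_F₂op_le_loc`, `B9Eq382V3Letters.eq369_diff_local`); `B9Ineq361L2Letters` (the `ℓ²` letters of
V′(A), site carrier).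
-/

noncomputable section

open scoped BigOperators

namespace Literature.MathematicalPhysics.QuantumFieldTheory.Balaban1983to89.B9Ineq373L2Letters

open NormedSpace Complex
open Literature.MathematicalPhysics.QuantumFieldTheory.Balaban1983to89
open Literature.MathematicalPhysics.QuantumFieldTheory.Balaban1983to89.B6RandomWalkL2 (l2n HasL2Majorant hasL2Majorant_mono
  hasL2Majorant_add)
open Literature.MathematicalPhysics.QuantumFieldTheory.Balaban1983to89.B9Thm34Ext (toB6)
open Literature.MathematicalPhysics.QuantumFieldTheory.Balaban1983to89.Beta.BackgroundVertices (ad norm_ad_le)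
open Literature.MathematicalPhysics.QuantumFieldTheory.Balaban1983to89.B9Eq39Adjoint
open Literature.MathematicalPhysics.QuantumFieldTheory.Balaban1983to89.B9Eq369Small
open Literature.MathematicalPhysics.QuantumFieldTheory.Balaban1983to89.B9Eq371Composition (norm_R_le_sq)
open Literature.MathematicalPhysics.QuantumFieldTheory.Balaban1983to89.B9Eq372Locality (stBonds pBonds dirBonds norm_F₁op_le_st)
open Literature.MathematicalPhysics.QuantumFieldTheory.Balaban1983to89.B9Eq375Locality (locBondsA locBondsA' dirBondsA' norm_F₂op_le_loc)
open Literature.MathematicalPhysics.QuantumFieldTheory.Balaban1983to89.B9Eq382V3Operator (kΔ_nonneg)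
open Literature.MathematicalPhysics.QuantumFieldTheory.Balaban1983to89.B9Eq352DivForm (tauF tauB tauF_apply tauB_apply)
open Literature.MathematicalPhysics.QuantumFieldTheory.Balaban1983to89.B9Eq352DivFormLetters (conj conj_sub conj_neg)
open Literature.MathematicalPhysics.QuantumFieldTheory.Balaban1983to89.B9Eq352GradLetters (coefLetter diffLetter conj_add)
open Literature.MathematicalPhysics.QuantumFieldTheory.Balaban1983to89.B9Eq371GradLetters (bT bU Ab zeroLetter mixLetterB mixLetterF V1Letter
  zeroLetter_apply mixLetterB_apply mixLetterF_apply V1Letter_inl V1Letter_inr)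
open Literature.MathematicalPhysics.QuantumFieldTheory.Balaban1983to89.B9Eq375GradLetters (zeroLetter₂ mixLetterB₂ mixLetterF₂ V1Letter₂
  zeroLetter₂_apply mixLetterB₂_apply mixLetterF₂_apply V1Letter₂_inl V1Letter₂_inr)
open Literature.MathematicalPhysics.QuantumFieldTheory.Balaban1983to89.B9Eq372RemLetters (F₁Letter F₂Letter F₁Letter_apply F₂Letter_apply
  growth growth_nonneg)
open Literature.MathematicalPhysics.QuantumFieldTheory.Balaban1983to89.B9Eq373V3 (kΔ)
open Literature.MathematicalPhysics.QuantumFieldTheory.Balaban1983to89.B9Eq382V3Letters (dPrimeLetter dPrimeLetter_apply eq369_diff_local cV0)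
open Literature.MathematicalPhysics.QuantumFieldTheory.Balaban1983to89.B9Ineq361L2Letters (hasL2Majorant_conj_of_local hasL2Majorant_coefLetter
  hasL2Majorant_sub)

/-! ## §0  Tools: the commutator size, transports, and the multiplicity of the bond stencils -/

section Tools

variable {𝔸 : Type*} [NormedRing 𝔸] [NormedAlgebra ℂ 𝔸]

/-- `‖i·[a, Z]‖ ≦ 2st` when `‖a‖ ≦ s`, `‖Z‖ ≦ t` (plumbing, as in the sup files). [folklore] -/
private theorem norm_I_ad_le {a Z : 𝔸} {s t : ℝ} (ha : ‖a‖ ≤ s) (hZ : ‖Z‖ ≤ t) : ‖(I : ℂ) • ad a Z‖ ≤ 2 * s * t := by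
  rw [norm_smul, Complex.norm_I, one_mul]
  have hs : 0 ≤ s := (norm_nonneg _).trans ha
  exact (norm_ad_le _ _).trans (mul_le_mul (mul_le_mul_of_nonneg_left ha zero_le_two) hZ (norm_nonneg _) (by positivity))

omit [NormedAlgebra ℂ 𝔸] in
/-- The transport bound `‖R(V)⁻¹Z‖ ≦ ρ²‖Z‖` for `‖V‖, ‖V⁻¹‖ ≦ ρ` (plumbing). [folklore] -/
private theorem norm_Rinv_le_sq (V : 𝔸ˣ) {ρ : ℝ} (h1 : ‖(V : 𝔸)‖ ≤ ρ) (h2 : ‖((V⁻¹ : 𝔸ˣ) : 𝔸)‖ ≤ ρ) (Z : 𝔸) :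
    ‖R V⁻¹ Z‖ ≤ ρ ^ 2 * ‖Z‖ :=
  norm_R_le_sq V⁻¹ h2 (by simpa using h1) Z

variable {S : Type} {κ : Type} [Fintype κ] (T : κ → Equiv.Perm S)

/-- **MULTIPLICITY OF THE BOND STENCILS**: if `near p q` forces `q.2 ∈ {p.2, T_a p.2, T_a⁻¹ p.2, T_a T_b⁻¹ p.2, T_b⁻¹ T_a p.2}` (all the stencils of
r06's letters are of these shapes), then every bond `q` lies in the stencil of at most `|κ|·(1 + 2|κ| + 2|κ|²)` bonds `p` — the column count the
block-`ℓ²` seam needs ([4] (2.140): a local letter read in `L²`). [cite: Balaban1984PropagatorsII, Prop. 2.6 (2.140) p.247 (bookkeeping, ours)] -/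
theorem mult_bond_of_shapes (near : κ × S → κ × S → Prop)
    (h : ∀ p q, near p q → q.2 = p.2 ∨ (∃ a, q.2 = T a p.2) ∨ (∃ a, q.2 = (T a).symm p.2) ∨
      (∃ a c, q.2 = T a ((T c).symm p.2)) ∨ ∃ a c, q.2 = (T c).symm (T a p.2)) :
    ∀ q : κ × S, ∃ s : Finset (κ × S),
      (s.card : ℝ) ≤ (Fintype.card κ * (1 + 2 * Fintype.card κ + 2 * Fintype.card κ ^ 2) : ℕ) ∧ ∀ p, near p q → p ∈ s := by
  classical
  intro q
  set s₀ : Finset S := insert q.2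
    (((Finset.univ.image fun a : κ => (T a).symm q.2) ∪ Finset.univ.image fun a : κ => T a q.2) ∪
      (((Finset.univ : Finset κ) ×ˢ (Finset.univ : Finset κ)).image fun ac : κ × κ => T ac.2 ((T ac.1).symm q.2)) ∪
        ((Finset.univ : Finset κ) ×ˢ (Finset.univ : Finset κ)).image fun ac : κ × κ => (T ac.1).symm (T ac.2 q.2)) with hs₀
  refine ⟨(Finset.univ : Finset κ) ×ˢ s₀, ?_, ?_⟩
  · have h1 : (Finset.univ.image fun a : κ => (T a).symm q.2).card ≤ Fintype.card κ := Finset.card_image_le.trans (by simp)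
    have h2 : (Finset.univ.image fun a : κ => T a q.2).card ≤ Fintype.card κ := Finset.card_image_le.trans (by simp)
    have h3 : (((Finset.univ : Finset κ) ×ˢ (Finset.univ : Finset κ)).image fun ac : κ × κ => T ac.2 ((T ac.1).symm q.2)).card ≤ Fintype.card κ ^ 2 :=
      Finset.card_image_le.trans (by simp [sq])
    have h4 : (((Finset.univ : Finset κ) ×ˢ (Finset.univ : Finset κ)).image fun ac : κ × κ => (T ac.1).symm (T ac.2 q.2)).card ≤ Fintype.card κ ^ 2 :=
      Finset.card_image_le.trans (by simp [sq])
    have hc : s₀.card ≤ 1 + 2 * Fintype.card κ + 2 * Fintype.card κ ^ 2 := by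
      rw [hs₀]
      refine (Finset.card_insert_le _ _).trans ?_
      have := Finset.card_union_le
        (((Finset.univ.image fun a : κ => (T a).symm q.2) ∪ Finset.univ.image fun a : κ => T a q.2) ∪
          (((Finset.univ : Finset κ) ×ˢ (Finset.univ : Finset κ)).image fun ac : κ × κ => T ac.2 ((T ac.1).symm q.2)))
        (((Finset.univ : Finset κ) ×ˢ (Finset.univ : Finset κ)).image fun ac : κ × κ => (T ac.1).symm (T ac.2 q.2))
      have := Finset.card_union_le
        ((Finset.univ.image fun a : κ => (T a).symm q.2) ∪ Finset.univ.image fun a : κ => T a q.2)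
        (((Finset.univ : Finset κ) ×ˢ (Finset.univ : Finset κ)).image fun ac : κ × κ => T ac.2 ((T ac.1).symm q.2))
      have := Finset.card_union_le (Finset.univ.image fun a : κ => (T a).symm q.2) (Finset.univ.image fun a : κ => T a q.2)
      omega
    have : ((Finset.univ : Finset κ) ×ˢ s₀).card ≤ Fintype.card κ * (1 + 2 * Fintype.card κ + 2 * Fintype.card κ ^ 2) := by
      rw [Finset.card_product, Finset.card_univ]
      exact Nat.mul_le_mul_left _ hc
    exact_mod_cast this
  · intro p hp
    refine Finset.mem_product.2 ⟨Finset.mem_univ _, ?_⟩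
    rw [hs₀]
    rcases h p q hp with h0 | ⟨a, ha⟩ | ⟨a, ha⟩ | ⟨a, c, hac⟩ | ⟨a, c, hac⟩
    · rw [← h0]; exact Finset.mem_insert_self _ _
    · refine Finset.mem_insert_of_mem (Finset.mem_union_left _ (Finset.mem_union_left _ (Finset.mem_union_left _
        (Finset.mem_image.2 ⟨a, Finset.mem_univ _, ?_⟩))))
      rw [ha]; simp
    · refine Finset.mem_insert_of_mem (Finset.mem_union_left _ (Finset.mem_union_left _ (Finset.mem_union_right _
        (Finset.mem_image.2 ⟨a, Finset.mem_univ _, ?_⟩))))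
      rw [ha]; simp
    · refine Finset.mem_insert_of_mem (Finset.mem_union_left _ (Finset.mem_union_right _
        (Finset.mem_image.2 ⟨(a, c), Finset.mem_product.2 ⟨Finset.mem_univ _, Finset.mem_univ _⟩, ?_⟩)))
      rw [hac]; simp
    · refine Finset.mem_insert_of_mem (Finset.mem_union_right _
        (Finset.mem_image.2 ⟨(a, c), Finset.mem_product.2 ⟨Finset.mem_univ _, Finset.mem_univ _⟩, ?_⟩))
      rw [hac]; simp

omit [Fintype κ] in
/-- The plaquette star `st(b)` of (3.72) is of the five shapes (bonds at `x`, `x ± e_a`, `x + e_a − e_c`).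
[cite: Balaban1985BackgroundPropagators, p.404 after (3.69) (bookkeeping, ours)] -/
theorem stBonds_shape {μ : κ} {x : S} {q : κ × S} (hq : q ∈ stBonds T μ x) :
    q.2 = x ∨ (∃ a, q.2 = T a x) ∨ (∃ a, q.2 = (T a).symm x) ∨ (∃ a c, q.2 = T a ((T c).symm x)) ∨ ∃ a c, q.2 = (T c).symm (T a x) := by
  obtain ⟨ν, -, hq⟩ := Set.mem_iUnion₂.mp hq
  simp only [dirBonds, pBonds, Set.mem_union, Set.mem_insert_iff, Set.mem_singleton_iff] at hq
  rcases hq with (rfl | rfl | rfl | rfl) | (rfl | rfl | rfl | rfl)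
  · exact Or.inl rfl
  · exact Or.inr (Or.inl ⟨ν, rfl⟩)
  · exact Or.inr (Or.inl ⟨μ, rfl⟩)
  · exact Or.inl rfl
  · exact Or.inr (Or.inr (Or.inl ⟨ν, rfl⟩))
  · exact Or.inr (Or.inr (Or.inr (Or.inl ⟨ν, ν, rfl⟩)))
  · exact Or.inr (Or.inr (Or.inr (Or.inl ⟨μ, ν, rfl⟩)))
  · exact Or.inr (Or.inr (Or.inl ⟨ν, rfl⟩))

omit [Fintype κ] in
/-- The (3.75)-stencil `locBondsA′(b)` is of the five shapes (bonds at `x + e_μ`, `x − e_ν`, `x + e_μ − e_ν`).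
[cite: Balaban1985BackgroundPropagators, (3.75) p.405 (bookkeeping, ours)] -/
theorem locBondsA'_shape {μ : κ} {x : S} {q : κ × S} (hq : q ∈ locBondsA' T μ x) :
    q.2 = x ∨ (∃ a, q.2 = T a x) ∨ (∃ a, q.2 = (T a).symm x) ∨ (∃ a c, q.2 = T a ((T c).symm x)) ∨ ∃ a c, q.2 = (T c).symm (T a x) := by
  obtain ⟨ν, hq⟩ := Set.mem_iUnion.mp hq
  simp only [dirBondsA', Set.mem_insert_iff, Set.mem_singleton_iff] at hq
  rcases hq with rfl | rfl | rfl
  · exact Or.inr (Or.inl ⟨μ, rfl⟩)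
  · exact Or.inr (Or.inr (Or.inl ⟨ν, rfl⟩))
  · exact Or.inr (Or.inr (Or.inr (Or.inr ⟨μ, ν, rfl⟩)))

end Tools

/-! ## §1  The bracket letters of `V₁(A)` (3.71) in block-ℓ² form -/

section V1

variable {𝔸 : Type*} [NormedRing 𝔸] [NormedAlgebra ℂ 𝔸] [CompleteSpace 𝔸] {ι : Type} [Fintype ι] [DecidableEq ι]
variable (b : Module.Basis ι ℝ 𝔸) {S : Type} [Fintype S] [DecidableEq S] {κ : Type} [Fintype κ] [DecidableEq κ]
variable (T : κ → Equiv.Perm S) (U : κ → S → 𝔸ˣ)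
variable {g : B9.Geometry} [Fintype g.Site] {Rr : ℝ} {H : Prop}

omit [CompleteSpace 𝔸] in
/-- **`hV1` FOR THE DIAGONAL COEFFICIENT LETTERS ON THE BOND CARRIER, IN ℓ²** (twin of `B9Eq371GradLetters.hasMajorant_coefLetter_bond`; this seat's
`hasL2Majorant_coefLetter` instantiated on the bond carrier): `conj b (coefLetter (inl/inr k)) ≺₂ 2M₂(Σ‖b_i‖)√#ι·e^{δd₀}·α₁(Lʲη)⁻¹·e^{−δd}`.
[cite: Balaban1985BackgroundPropagators, (3.37) p.396 + (3.71) p.404 + (3.73) p.405; Balaban1984PropagatorsII, Prop. 2.6 (2.140) p.247; derivation ours] -/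
theorem hasL2Majorant_coefLetter_bond (blk : S → g.Site) (A : κ → S → 𝔸) (d₀ δ M₂ α₁ : ℝ)
    (hα₁ : 0 ≤ α₁) (hδ : 0 ≤ δ) (hM₂ : 0 ≤ M₂) (hrepr : ∀ (v : 𝔸) (i : ι), |b.repr v i| ≤ M₂ * ‖v‖)
    (hlen : ∀ y : g.Site, 0 < g.len y)
    (hA : ∀ μ x, ‖A μ x‖ ≤ α₁ * (g.len (blk x))⁻¹ ∧ ‖tauB T U μ (A μ) x‖ ≤ α₁ * (g.len (blk x))⁻¹)
    (hd₀0 : ∀ y : g.Site, g.dist y y ≤ d₀) (k : κ ⊕ κ) :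
    HasL2Majorant (g := toB6 g Rr H) (fun q : (κ × S) × ι => blk q.1.2) (conj b (coefLetter (bT T) (bU U) (Ab A) k))
      (fun y y' => (2 * M₂ * (∑ i, ‖b i‖) * Real.sqrt ((1 * Fintype.card ι : ℕ) : ℝ) * Real.exp (δ * d₀)) * α₁ * (g.len y)⁻¹ *
        Real.exp (-(δ * g.dist y y'))) :=
  hasL2Majorant_coefLetter (Rr := Rr) (H := H) b (bT T) (bU U) (fun p : κ × S => blk p.2) (Ab A) d₀ δ M₂ α₁ hα₁ hδ hM₂ hrepr
    hlen (fun μ p => hA μ p.2) hd₀0 k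

omit [CompleteSpace 𝔸] T U in
/-- **`hV1` FOR THE BACKWARD MIXING LETTER, IN ℓ²** (twin of `B9Eq371GradLetters.hasMajorant_mixLetterB`; stencil `{x}`):
`conj b (mixLetterB A k₀) ≺₂ 2M₂(Σ‖b_i‖)√(N#ι)·e^{δd₀}·α₁(Lʲη)⁻¹·e^{−δd}`, `N = |κ|(1 + 2|κ| + 2|κ|²)` (the common multiplicity count of §0).
[cite: Balaban1985BackgroundPropagators, (3.37) p.396 + (3.71) p.405 + (3.73) p.405; Balaban1984PropagatorsII, Prop. 2.6 (2.140) p.247; derivation ours] -/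
theorem hasL2Majorant_mixLetterB (blk : S → g.Site) (A : κ → S → 𝔸) (d₀ δ M₂ α₁ : ℝ)
    (hα₁ : 0 ≤ α₁) (hδ : 0 ≤ δ) (hM₂ : 0 ≤ M₂) (hrepr : ∀ (v : 𝔸) (i : ι), |b.repr v i| ≤ M₂ * ‖v‖)
    (hlen : ∀ y : g.Site, 0 < g.len y) (hA : ∀ k x, ‖A k x‖ ≤ α₁ * (g.len (blk x))⁻¹)
    (hd₀0 : ∀ y : g.Site, g.dist y y ≤ d₀) (k₀ : κ) :
    HasL2Majorant (g := toB6 g Rr H) (fun q : (κ × S) × ι => blk q.1.2) (conj b (mixLetterB A k₀))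
      (fun y y' => (2 * M₂ * (∑ i, ‖b i‖) *
          Real.sqrt (((Fintype.card κ * (1 + 2 * Fintype.card κ + 2 * Fintype.card κ ^ 2)) * Fintype.card ι : ℕ) : ℝ) *
          Real.exp (δ * d₀)) * α₁ * (g.len y)⁻¹ * Real.exp (-(δ * g.dist y y'))) := by
  have hc0 : ∀ y : g.Site, 0 ≤ 2 * α₁ * (g.len y)⁻¹ := fun y => by have := hlen y; positivity
  refine hasL2Majorant_mono (g := toB6 g Rr H) _
    (hasL2Majorant_conj_of_local (Rr := Rr) (H := H) b (fun p : κ × S => blk p.2) (fun p q => q.2 = p.2)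
      (fun y => 2 * α₁ * (g.len y)⁻¹) d₀ δ M₂ _ hc0 hδ hM₂ hrepr (fun p q h => by rw [h]; exact hd₀0 _)
      (mult_bond_of_shapes (fun _ : κ => Equiv.refl S) _ fun p q h => Or.inl h) (mixLetterB A k₀) ?_)
    fun y y' => le_of_eq (by ring)
  intro F p B hB
  rw [mixLetterB_apply, norm_neg]
  calc ‖(I : ℂ) • ad (A p.1 p.2) (F (k₀, p.2))‖ ≤ 2 * (α₁ * (g.len (blk p.2))⁻¹) * B :=
        norm_I_ad_le (hA p.1 p.2) (hB (k₀, p.2) rfl)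
    _ = 2 * α₁ * (g.len (blk p.2))⁻¹ * B := by ring

omit [CompleteSpace 𝔸] in
/-- **`hV0` FOR THE ZEROTH-ORDER LETTER OF THE BRACKET OF (3.71), IN ℓ²** (twin of `B9Eq371GradLetters.hasMajorant_zeroLetter`; backward nearest-neighbour
stencil): `conj b (zeroLetter c A) ≺₂ 2(1+ρ²)d·M₂(Σ‖b_i‖)√(N#ι)·e^{δd₀}·α₁(Lʲη)⁻²·e^{−δd}`.
[cite: Balaban1985BackgroundPropagators, (3.37) p.396 + (3.71) p.404–405 + (3.73) p.405; Balaban1984PropagatorsII, Prop. 2.6 (2.140) p.247; derivation ours] -/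
theorem hasL2Majorant_zeroLetter (blk : S → g.Site) (c : ℂ) (A : κ → S → 𝔸) (ρ d₀ δ M₂ α₁ : ℝ)
    (hα₁ : 0 ≤ α₁) (hδ : 0 ≤ δ) (hM₂ : 0 ≤ M₂) (hrepr : ∀ (v : 𝔸) (i : ι), |b.repr v i| ≤ M₂ * ‖v‖)
    (h337 : ∀ ν k x, ‖c • covDstar T U ν (A k) x‖ ≤ α₁ * (g.len (blk x) ^ 2)⁻¹)
    (hρ : ∀ μ x, ‖((U μ x : 𝔸ˣ) : 𝔸)‖ ≤ ρ ∧ ‖(((U μ x)⁻¹ : 𝔸ˣ) : 𝔸)‖ ≤ ρ)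
    (hd₀ : ∀ μ x, g.dist (blk x) (blk ((T μ).symm x)) ≤ d₀) (hd₀0 : ∀ y : g.Site, g.dist y y ≤ d₀) :
    HasL2Majorant (g := toB6 g Rr H) (fun q : (κ × S) × ι => blk q.1.2) (conj b (zeroLetter T U c A))
      (fun y y' => (2 * (1 + ρ ^ 2) * Fintype.card κ * M₂ * (∑ i, ‖b i‖) *
          Real.sqrt (((Fintype.card κ * (1 + 2 * Fintype.card κ + 2 * Fintype.card κ ^ 2)) * Fintype.card ι : ℕ) : ℝ) *
          Real.exp (δ * d₀)) * α₁ * (g.len y ^ 2)⁻¹ * Real.exp (-(δ * g.dist y y'))) := by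
  have hc0 : ∀ y : g.Site, 0 ≤ 2 * (1 + ρ ^ 2) * Fintype.card κ * α₁ * (g.len y ^ 2)⁻¹ := fun y => by positivity
  refine hasL2Majorant_mono (g := toB6 g Rr H) _
    (hasL2Majorant_conj_of_local (Rr := Rr) (H := H) b (fun p : κ × S => blk p.2)
      (fun p q => q.2 = p.2 ∨ ∃ ν, q.2 = (T ν).symm p.2)
      (fun y => 2 * (1 + ρ ^ 2) * Fintype.card κ * α₁ * (g.len y ^ 2)⁻¹) d₀ δ M₂ _ hc0 hδ hM₂ hrepr ?_
      (mult_bond_of_shapes T _ fun p q h => ?_) (zeroLetter T U c A) ?_)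
    fun y y' => le_of_eq (by ring)
  · rintro p q (h | ⟨ν, h⟩)
    · rw [h]; exact hd₀0 _
    · rw [h]; exact hd₀ ν p.2
  · rcases h with h | ⟨ν, h⟩
    · exact Or.inl h
    · exact Or.inr (Or.inr (Or.inl ⟨ν, h⟩))
  · intro F p B hB
    rw [zeroLetter_apply]
    have hterm : ∀ ν, ‖-((I : ℂ) • ad (c • covDstar T U ν (A ν) p.2) (F p))
        + (I : ℂ) • ad (c • covDstar T U ν (A p.1) p.2) (tauB T U ν (fun z => F (ν, z)) p.2)‖
        ≤ 2 * (1 + ρ ^ 2) * (α₁ * (g.len (blk p.2) ^ 2)⁻¹) * B := by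
      intro ν
      have hτF : ‖tauB T U ν (fun z => F (ν, z)) p.2‖ ≤ ρ ^ 2 * B := by
        rw [tauB_apply]
        refine (norm_Rinv_le_sq _ (hρ ν _).1 (hρ ν _).2 _).trans ?_
        exact mul_le_mul_of_nonneg_left (hB (ν, (T ν).symm p.2) (Or.inr ⟨ν, rfl⟩)) (sq_nonneg _)
      have h1 : ‖(I : ℂ) • ad (c • covDstar T U ν (A ν) p.2) (F p)‖ ≤ 2 * (α₁ * (g.len (blk p.2) ^ 2)⁻¹) * B :=
        norm_I_ad_le (h337 ν ν p.2) (hB p (Or.inl rfl))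
      have h2 : ‖(I : ℂ) • ad (c • covDstar T U ν (A p.1) p.2) (tauB T U ν (fun z => F (ν, z)) p.2)‖
          ≤ 2 * (α₁ * (g.len (blk p.2) ^ 2)⁻¹) * (ρ ^ 2 * B) :=
        norm_I_ad_le (h337 ν p.1 p.2) hτF
      calc _ ≤ ‖-((I : ℂ) • ad (c • covDstar T U ν (A ν) p.2) (F p))‖
              + ‖(I : ℂ) • ad (c • covDstar T U ν (A p.1) p.2) (tauB T U ν (fun z => F (ν, z)) p.2)‖ :=
            norm_add_le _ _
        _ ≤ 2 * (α₁ * (g.len (blk p.2) ^ 2)⁻¹) * B + 2 * (α₁ * (g.len (blk p.2) ^ 2)⁻¹) * (ρ ^ 2 * B) := by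
            rw [norm_neg]; exact add_le_add h1 h2
        _ = 2 * (1 + ρ ^ 2) * (α₁ * (g.len (blk p.2) ^ 2)⁻¹) * B := by ring
    refine (norm_sum_le _ _).trans ?_
    calc ∑ ν, ‖-((I : ℂ) • ad (c • covDstar T U ν (A ν) p.2) (F p))
            + (I : ℂ) • ad (c • covDstar T U ν (A p.1) p.2) (tauB T U ν (fun z => F (ν, z)) p.2)‖
          ≤ ∑ _ν : κ, 2 * (1 + ρ ^ 2) * (α₁ * (g.len (blk p.2) ^ 2)⁻¹) * B := Finset.sum_le_sum fun ν _ => hterm ν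
      _ = 2 * (1 + ρ ^ 2) * Fintype.card κ * α₁ * (g.len (blk p.2) ^ 2)⁻¹ * B := by
          rw [Finset.sum_const, Finset.card_univ, nsmul_eq_mul]; ring

omit [CompleteSpace 𝔸] in
/-- **`hV1` FOR THE FORWARD MIXING LETTER, IN ℓ²** (twin of `B9Eq371GradLetters.hasMajorant_mixLetterF`; backward nearest-neighbour stencil):
`conj b (mixLetterF A k₀) ≺₂ 2(1+2ρ²)d·M₂(Σ‖b_i‖)√(N#ι)·e^{δd₀}·α₁(Lʲη)⁻¹·e^{−δd}`.
[cite: Balaban1985BackgroundPropagators, (3.37) p.396 + (3.71) p.404–405 + (3.73) p.405; Balaban1984PropagatorsII, Prop. 2.6 (2.140) p.247; derivation ours] -/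
theorem hasL2Majorant_mixLetterF (blk : S → g.Site) (A : κ → S → 𝔸) (ρ d₀ δ M₂ α₁ : ℝ)
    (hα₁ : 0 ≤ α₁) (hδ : 0 ≤ δ) (hM₂ : 0 ≤ M₂) (hrepr : ∀ (v : 𝔸) (i : ι), |b.repr v i| ≤ M₂ * ‖v‖)
    (hlen : ∀ y : g.Site, 0 < g.len y)
    (hA : ∀ k x, ‖A k x‖ ≤ α₁ * (g.len (blk x))⁻¹) (hAτ : ∀ ν k x, ‖tauB T U ν (A k) x‖ ≤ α₁ * (g.len (blk x))⁻¹)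
    (hρ : ∀ μ x, ‖((U μ x : 𝔸ˣ) : 𝔸)‖ ≤ ρ ∧ ‖(((U μ x)⁻¹ : 𝔸ˣ) : 𝔸)‖ ≤ ρ)
    (hd₀ : ∀ μ x, g.dist (blk x) (blk ((T μ).symm x)) ≤ d₀) (hd₀0 : ∀ y : g.Site, g.dist y y ≤ d₀) (k₀ : κ) :
    HasL2Majorant (g := toB6 g Rr H) (fun q : (κ × S) × ι => blk q.1.2) (conj b (mixLetterF T U A k₀))
      (fun y y' => (2 * (1 + 2 * ρ ^ 2) * Fintype.card κ * M₂ * (∑ i, ‖b i‖) *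
          Real.sqrt (((Fintype.card κ * (1 + 2 * Fintype.card κ + 2 * Fintype.card κ ^ 2)) * Fintype.card ι : ℕ) : ℝ) *
          Real.exp (δ * d₀)) * α₁ * (g.len y)⁻¹ * Real.exp (-(δ * g.dist y y'))) := by
  have hc0 : ∀ y : g.Site, 0 ≤ 2 * (1 + 2 * ρ ^ 2) * Fintype.card κ * α₁ * (g.len y)⁻¹ := fun y => by
    have := hlen y; positivity
  refine hasL2Majorant_mono (g := toB6 g Rr H) _
    (hasL2Majorant_conj_of_local (Rr := Rr) (H := H) b (fun p : κ × S => blk p.2)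
      (fun p q => q.2 = p.2 ∨ ∃ ν, q.2 = (T ν).symm p.2)
      (fun y => 2 * (1 + 2 * ρ ^ 2) * Fintype.card κ * α₁ * (g.len y)⁻¹) d₀ δ M₂ _ hc0 hδ hM₂ hrepr ?_
      (mult_bond_of_shapes T _ fun p q h => ?_) (mixLetterF T U A k₀) ?_)
    fun y y' => le_of_eq (by ring)
  · rintro p q (h | ⟨ν, h⟩)
    · rw [h]; exact hd₀0 _
    · rw [h]; exact hd₀ ν p.2
  · rcases h with h | ⟨ν, h⟩
    · exact Or.inl h
    · exact Or.inr (Or.inr (Or.inl ⟨ν, h⟩))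
  · intro F p B hB
    have hB0 : 0 ≤ B := (norm_nonneg _).trans (hB p (Or.inl rfl))
    rw [mixLetterF_apply]
    have hterm : ∀ ν, ‖-((I : ℂ) • ad (tauB T U ν (A ν) p.2) (tauB T U ν (fun z => F (ν, z)) p.2))
        + (I : ℂ) • ad (tauB T U ν (A k₀) p.2) (tauB T U ν (fun z => F (ν, z)) p.2)
        - (I : ℂ) • ad (A k₀ p.2) (F (ν, p.2))‖ ≤ 2 * (1 + 2 * ρ ^ 2) * (α₁ * (g.len (blk p.2))⁻¹) * B := by
      intro ν
      have hτF : ‖tauB T U ν (fun z => F (ν, z)) p.2‖ ≤ ρ ^ 2 * B := by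
        rw [tauB_apply]
        refine (norm_Rinv_le_sq _ (hρ ν _).1 (hρ ν _).2 _).trans ?_
        exact mul_le_mul_of_nonneg_left (hB (ν, (T ν).symm p.2) (Or.inr ⟨ν, rfl⟩)) (sq_nonneg _)
      have h1 : ‖(I : ℂ) • ad (tauB T U ν (A ν) p.2) (tauB T U ν (fun z => F (ν, z)) p.2)‖
          ≤ 2 * (α₁ * (g.len (blk p.2))⁻¹) * (ρ ^ 2 * B) := norm_I_ad_le (hAτ ν ν p.2) hτF
      have h2 : ‖(I : ℂ) • ad (tauB T U ν (A k₀) p.2) (tauB T U ν (fun z => F (ν, z)) p.2)‖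
          ≤ 2 * (α₁ * (g.len (blk p.2))⁻¹) * (ρ ^ 2 * B) := norm_I_ad_le (hAτ ν k₀ p.2) hτF
      have h3 : ‖(I : ℂ) • ad (A k₀ p.2) (F (ν, p.2))‖ ≤ 2 * (α₁ * (g.len (blk p.2))⁻¹) * B :=
        norm_I_ad_le (hA k₀ p.2) (hB (ν, p.2) (Or.inl rfl))
      calc _ ≤ ‖-((I : ℂ) • ad (tauB T U ν (A ν) p.2) (tauB T U ν (fun z => F (ν, z)) p.2))
              + (I : ℂ) • ad (tauB T U ν (A k₀) p.2) (tauB T U ν (fun z => F (ν, z)) p.2)‖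
              + ‖(I : ℂ) • ad (A k₀ p.2) (F (ν, p.2))‖ := norm_sub_le _ _
        _ ≤ (‖-((I : ℂ) • ad (tauB T U ν (A ν) p.2) (tauB T U ν (fun z => F (ν, z)) p.2))‖
              + ‖(I : ℂ) • ad (tauB T U ν (A k₀) p.2) (tauB T U ν (fun z => F (ν, z)) p.2)‖)
              + ‖(I : ℂ) • ad (A k₀ p.2) (F (ν, p.2))‖ := add_le_add (norm_add_le _ _) le_rfl
        _ = (‖(I : ℂ) • ad (tauB T U ν (A ν) p.2) (tauB T U ν (fun z => F (ν, z)) p.2)‖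
              + ‖(I : ℂ) • ad (tauB T U ν (A k₀) p.2) (tauB T U ν (fun z => F (ν, z)) p.2)‖)
              + ‖(I : ℂ) • ad (A k₀ p.2) (F (ν, p.2))‖ := by rw [norm_neg]
        _ ≤ (2 * (α₁ * (g.len (blk p.2))⁻¹) * (ρ ^ 2 * B) + 2 * (α₁ * (g.len (blk p.2))⁻¹) * (ρ ^ 2 * B))
              + 2 * (α₁ * (g.len (blk p.2))⁻¹) * B := add_le_add (add_le_add h1 h2) h3
        _ = 2 * (1 + 2 * ρ ^ 2) * (α₁ * (g.len (blk p.2))⁻¹) * B := by ring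
    have hsum : ‖∑ ν, (-((I : ℂ) • ad (tauB T U ν (A ν) p.2) (tauB T U ν (fun z => F (ν, z)) p.2))
        + (I : ℂ) • ad (tauB T U ν (A k₀) p.2) (tauB T U ν (fun z => F (ν, z)) p.2)
        - (I : ℂ) • ad (A k₀ p.2) (F (ν, p.2)))‖
        ≤ Fintype.card κ * (2 * (1 + 2 * ρ ^ 2) * (α₁ * (g.len (blk p.2))⁻¹) * B) := by
      refine (norm_sum_le _ _).trans ?_
      rw [← Finset.card_univ, ← nsmul_eq_mul, ← Finset.sum_const]
      exact Finset.sum_le_sum fun ν _ => hterm ν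
    split_ifs with h
    · rw [one_smul]
      refine hsum.trans (le_of_eq ?_)
      ring
    · rw [zero_smul, norm_zero]
      exact mul_nonneg (hc0 _) hB0

omit [CompleteSpace 𝔸] in
/-- ★ **`hV1` FOR EVERY COEFFICIENT LETTER `V¹_k` OF THE BRACKET OF (3.71), IN ℓ²** (twin of `B9Eq371GradLetters.hasMajorant_V1Letter`; `k ∈ κ ⊕ κ`):
`conj b (V1Letter A k) ≺₂ c_B·√(N#ι)·α₁(Lʲη)⁻¹e^{−δd}`, `c_B = 2(2 + 2ρ²)(d + 1)·M₂(Σ‖b_i‖)e^{δd₀}` (the diagonal part at multiplicity 1 is bounded by the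
common count `N ≧ 1`). [cite: Balaban1985BackgroundPropagators, (3.37) p.396 + (3.71) p.404–405 + (3.73) p.405; Balaban1984PropagatorsII, Prop. 2.6 (2.140) p.247; derivation ours] -/
theorem hasL2Majorant_V1Letter (blk : S → g.Site) (A : κ → S → 𝔸) (ρ d₀ δ M₂ α₁ : ℝ)
    (hα₁ : 0 ≤ α₁) (hδ : 0 ≤ δ) (hM₂ : 0 ≤ M₂) (hrepr : ∀ (v : 𝔸) (i : ι), |b.repr v i| ≤ M₂ * ‖v‖)
    (hlen : ∀ y : g.Site, 0 < g.len y)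
    (hA : ∀ k x, ‖A k x‖ ≤ α₁ * (g.len (blk x))⁻¹) (hAτ : ∀ ν k x, ‖tauB T U ν (A k) x‖ ≤ α₁ * (g.len (blk x))⁻¹)
    (hρ : ∀ μ x, ‖((U μ x : 𝔸ˣ) : 𝔸)‖ ≤ ρ ∧ ‖(((U μ x)⁻¹ : 𝔸ˣ) : 𝔸)‖ ≤ ρ)
    (hd₀ : ∀ μ x, g.dist (blk x) (blk ((T μ).symm x)) ≤ d₀) (hd₀0 : ∀ y : g.Site, g.dist y y ≤ d₀) (k : κ ⊕ κ) :
    HasL2Majorant (g := toB6 g Rr H) (fun q : (κ × S) × ι => blk q.1.2) (conj b (V1Letter T U A k))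
      (fun y y' => (2 * (2 + 2 * ρ ^ 2) * (Fintype.card κ + 1) * M₂ * (∑ i, ‖b i‖) *
          Real.sqrt (((Fintype.card κ * (1 + 2 * Fintype.card κ + 2 * Fintype.card κ ^ 2)) * Fintype.card ι : ℕ) : ℝ) *
          Real.exp (δ * d₀)) * α₁ * (g.len y)⁻¹ * Real.exp (-(δ * g.dist y y'))) := by
  set sN : ℝ := Real.sqrt (((Fintype.card κ * (1 + 2 * Fintype.card κ + 2 * Fintype.card κ ^ 2)) * Fintype.card ι : ℕ) : ℝ) with hsN
  have hs1 : Real.sqrt ((1 * Fintype.card ι : ℕ) : ℝ) ≤ sN := by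
    rw [hsN]
    apply Real.sqrt_le_sqrt
    have hk : 1 ≤ Fintype.card κ := Fintype.card_pos_iff.mpr (by
      rcases k with k₀ | k₀ <;> exact ⟨k₀⟩)
    have : 1 * Fintype.card ι ≤ (Fintype.card κ * (1 + 2 * Fintype.card κ + 2 * Fintype.card κ ^ 2)) * Fintype.card ι :=
      Nat.mul_le_mul_right _ (by nlinarith)
    exact_mod_cast this
  have hcoef0 := hasL2Majorant_coefLetter_bond (Rr := Rr) (H := H) b T U blk A d₀ δ M₂ α₁ hα₁ hδ hM₂ hrepr hlen
    (fun μ x => ⟨hA μ x, hAτ μ μ x⟩) hd₀0 k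
  have hw : ∀ y y' : g.Site, 0 ≤ M₂ * (∑ i, ‖b i‖) * Real.exp (δ * d₀) * α₁ * (g.len y)⁻¹ *
      Real.exp (-(δ * g.dist y y')) := fun y y' => by
    have := hlen y; have : 0 ≤ ∑ i, ‖b i‖ := Finset.sum_nonneg fun i _ => norm_nonneg _; positivity
  have hcoef : HasL2Majorant (g := toB6 g Rr H) (fun q : (κ × S) × ι => blk q.1.2) (conj b (coefLetter (bT T) (bU U) (Ab A) k))
      (fun y y' => (2 * M₂ * (∑ i, ‖b i‖) * sN * Real.exp (δ * d₀)) * α₁ * (g.len y)⁻¹ * Real.exp (-(δ * g.dist y y'))) := by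
    refine hasL2Majorant_mono (g := toB6 g Rr H) _ hcoef0 fun y y' => ?_
    have := mul_le_mul_of_nonneg_left hs1 (mul_nonneg zero_le_two (hw y y'))
    nlinarith [this]
  have hκ : (0 : ℝ) ≤ Fintype.card κ := Nat.cast_nonneg _
  have hsN0 : 0 ≤ sN := Real.sqrt_nonneg _
  have hw' : ∀ y y' : g.Site, 0 ≤ sN * (M₂ * (∑ i, ‖b i‖) * Real.exp (δ * d₀) * α₁ * (g.len y)⁻¹ *
      Real.exp (-(δ * g.dist y y'))) := fun y y' => mul_nonneg hsN0 (hw y y')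
  rcases k with k₀ | k₀
  · rw [V1Letter_inl, conj_add]
    refine hasL2Majorant_mono (g := toB6 g Rr H) _
      (hasL2Majorant_add (g := toB6 g Rr H) _ hcoef
        (hasL2Majorant_mixLetterF (Rr := Rr) (H := H) b T U blk A ρ d₀ δ M₂ α₁ hα₁ hδ hM₂ hrepr hlen hA hAτ hρ hd₀ hd₀0 k₀))
      fun y y' => ?_
    nlinarith [hw' y y', mul_nonneg hκ (hw' y y'), mul_nonneg (sq_nonneg ρ) (hw' y y'),
      mul_nonneg (mul_nonneg (sq_nonneg ρ) hκ) (hw' y y')]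
  · rw [V1Letter_inr, conj_add]
    refine hasL2Majorant_mono (g := toB6 g Rr H) _
      (hasL2Majorant_add (g := toB6 g Rr H) _ hcoef
        (hasL2Majorant_mixLetterB (Rr := Rr) (H := H) b blk A d₀ δ M₂ α₁ hα₁ hδ hM₂ hrepr hlen hA hd₀0 k₀))
      fun y y' => ?_
    nlinarith [hw' y y', mul_nonneg hκ (hw' y y'), mul_nonneg (sq_nonneg ρ) (hw' y y'),
      mul_nonneg (mul_nonneg (sq_nonneg ρ) hκ) (hw' y y')]

end V1

/-! ## §2  The bracket letters of `V₂(A)` (3.75) in block-ℓ² form -/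

section V2

variable {𝔸 : Type*} [NormedRing 𝔸] [NormedAlgebra ℂ 𝔸] [CompleteSpace 𝔸] {ι : Type} [Fintype ι] [DecidableEq ι]
variable (b : Module.Basis ι ℝ 𝔸) {S : Type} [Fintype S] [DecidableEq S] {κ : Type} [Fintype κ] [DecidableEq κ]
variable (T : κ → Equiv.Perm S) (U : κ → S → 𝔸ˣ)
variable {g : B9.Geometry} [Fintype g.Site] {Rr : ℝ} {H : Prop}

omit [CompleteSpace 𝔸] in
/-- **`hV1` FOR THE BACKWARD COEFFICIENT LETTER OF (3.75), IN ℓ²** (twin of `B9Eq375GradLetters.hasMajorant_mixLetterB₂`; forward nearest-neighbour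
stencil): `conj b (mixLetterB₂ A k₀) ≺₂ 2(1+2ρ²)·M₂(Σ‖b_i‖)√(N#ι)·e^{δd₀}·α₁(Lʲη)⁻¹·e^{−δd}`.
[cite: Balaban1985BackgroundPropagators, (3.37) p.396 + (3.75) p.405 + (3.73) p.405; Balaban1984PropagatorsII, Prop. 2.6 (2.140) p.247; derivation ours] -/
theorem hasL2Majorant_mixLetterB₂ (blk : S → g.Site) (A : κ → S → 𝔸) (ρ d₀ δ M₂ α₁ : ℝ)
    (hα₁ : 0 ≤ α₁) (hδ : 0 ≤ δ) (hM₂ : 0 ≤ M₂) (hrepr : ∀ (v : 𝔸) (i : ι), |b.repr v i| ≤ M₂ * ‖v‖)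
    (hlen : ∀ y : g.Site, 0 < g.len y)
    (hA : ∀ k x, ‖A k x‖ ≤ α₁ * (g.len (blk x))⁻¹) (hAτ : ∀ μ k x, ‖tauF T U μ (A k) x‖ ≤ α₁ * (g.len (blk x))⁻¹)
    (hρ : ∀ μ x, ‖((U μ x : 𝔸ˣ) : 𝔸)‖ ≤ ρ ∧ ‖(((U μ x)⁻¹ : 𝔸ˣ) : 𝔸)‖ ≤ ρ)
    (hd₀F : ∀ μ x, g.dist (blk x) (blk (T μ x)) ≤ d₀) (hd₀0 : ∀ y : g.Site, g.dist y y ≤ d₀) (k₀ : κ) :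
    HasL2Majorant (g := toB6 g Rr H) (fun q : (κ × S) × ι => blk q.1.2) (conj b (mixLetterB₂ T U A k₀))
      (fun y y' => (2 * (1 + 2 * ρ ^ 2) * M₂ * (∑ i, ‖b i‖) *
          Real.sqrt (((Fintype.card κ * (1 + 2 * Fintype.card κ + 2 * Fintype.card κ ^ 2)) * Fintype.card ι : ℕ) : ℝ) *
          Real.exp (δ * d₀)) * α₁ * (g.len y)⁻¹ * Real.exp (-(δ * g.dist y y'))) := by
  have hc0 : ∀ y : g.Site, 0 ≤ 2 * (1 + 2 * ρ ^ 2) * α₁ * (g.len y)⁻¹ := fun y => by have := hlen y; positivity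
  refine hasL2Majorant_mono (g := toB6 g Rr H) _
    (hasL2Majorant_conj_of_local (Rr := Rr) (H := H) b (fun p : κ × S => blk p.2)
      (fun p q => q.2 = p.2 ∨ ∃ μ, q.2 = T μ p.2)
      (fun y => 2 * (1 + 2 * ρ ^ 2) * α₁ * (g.len y)⁻¹) d₀ δ M₂ _ hc0 hδ hM₂ hrepr ?_
      (mult_bond_of_shapes T _ fun p q h => ?_) (mixLetterB₂ T U A k₀) ?_)
    fun y y' => le_of_eq (by ring)
  · rintro p q (h | ⟨μ, h⟩)
    · rw [h]; exact hd₀0 _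
    · rw [h]; exact hd₀F μ p.2
  · rcases h with h | ⟨μ, h⟩
    · exact Or.inl h
    · exact Or.inr (Or.inl ⟨μ, h⟩)
  · intro G p B hB
    have hτG : ‖tauF T U p.1 (fun z => G (k₀, z)) p.2‖ ≤ ρ ^ 2 * B := by
      rw [tauF_apply]
      refine (norm_R_le_sq _ (hρ p.1 _).1 (hρ p.1 _).2 _).trans ?_
      exact mul_le_mul_of_nonneg_left (hB (k₀, T p.1 p.2) (Or.inr ⟨p.1, rfl⟩)) (sq_nonneg _)
    have h1 : ‖(I : ℂ) • ad (A p.1 p.2) (tauF T U p.1 (fun z => G (k₀, z)) p.2)‖ ≤ 2 * (α₁ * (g.len (blk p.2))⁻¹) * (ρ ^ 2 * B) :=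
      norm_I_ad_le (hA p.1 p.2) hτG
    have h2 : ‖(I : ℂ) • ad (tauF T U p.1 (A k₀) p.2) (tauF T U p.1 (fun z => G (k₀, z)) p.2)‖
        ≤ 2 * (α₁ * (g.len (blk p.2))⁻¹) * (ρ ^ 2 * B) := norm_I_ad_le (hAτ p.1 k₀ p.2) hτG
    have h3 : ‖(I : ℂ) • ad (A k₀ p.2) (G (k₀, p.2))‖ ≤ 2 * (α₁ * (g.len (blk p.2))⁻¹) * B :=
      norm_I_ad_le (hA k₀ p.2) (hB (k₀, p.2) (Or.inl rfl))
    rw [mixLetterB₂_apply]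
    calc _ ≤ ‖(I : ℂ) • ad (A p.1 p.2) (tauF T U p.1 (fun z => G (k₀, z)) p.2)
              - (I : ℂ) • ad (tauF T U p.1 (A k₀) p.2) (tauF T U p.1 (fun z => G (k₀, z)) p.2)‖
            + ‖(I : ℂ) • ad (A k₀ p.2) (G (k₀, p.2))‖ := norm_add_le _ _
      _ ≤ (‖(I : ℂ) • ad (A p.1 p.2) (tauF T U p.1 (fun z => G (k₀, z)) p.2)‖
              + ‖(I : ℂ) • ad (tauF T U p.1 (A k₀) p.2) (tauF T U p.1 (fun z => G (k₀, z)) p.2)‖)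
            + ‖(I : ℂ) • ad (A k₀ p.2) (G (k₀, p.2))‖ := add_le_add (norm_sub_le _ _) le_rfl
      _ ≤ (2 * (α₁ * (g.len (blk p.2))⁻¹) * (ρ ^ 2 * B) + 2 * (α₁ * (g.len (blk p.2))⁻¹) * (ρ ^ 2 * B))
            + 2 * (α₁ * (g.len (blk p.2))⁻¹) * B := add_le_add (add_le_add h1 h2) h3
      _ = 2 * (1 + 2 * ρ ^ 2) * α₁ * (g.len (blk p.2))⁻¹ * B := by ring

omit [CompleteSpace 𝔸] in
/-- **`hV0` FOR THE ZEROTH-ORDER LETTER OF THE BRACKET OF (3.75), IN ℓ²** (twin of `B9Eq375GradLetters.hasMajorant_zeroLetter₂`; forward, backward and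
forward-backward neighbours): `conj b (zeroLetter₂ c A) ≺₂ 2(2ρ²+ρ⁶)d·M₂(Σ‖b_i‖)√(N#ι)·e^{δd₀}·α₁(Lʲη)⁻²·e^{−δd}`.
[cite: Balaban1985BackgroundPropagators, (3.37) p.396 + (3.75) p.405 + (3.73) p.405; Balaban1984PropagatorsII, Prop. 2.6 (2.140) p.247; derivation ours] -/
theorem hasL2Majorant_zeroLetter₂ (blk : S → g.Site) (c : ℂ) (A : κ → S → 𝔸) (ρ d₀ δ M₂ α₁ : ℝ)
    (hα₁ : 0 ≤ α₁) (hδ : 0 ≤ δ) (hM₂ : 0 ≤ M₂) (hrepr : ∀ (v : 𝔸) (i : ι), |b.repr v i| ≤ M₂ * ‖v‖)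
    (h337F : ∀ μ ν x, ‖c • covD T U μ (A ν) x‖ ≤ α₁ * (g.len (blk x) ^ 2)⁻¹)
    (h337B : ∀ ν x, ‖c • covDstar T U ν (A ν) x‖ ≤ α₁ * (g.len (blk x) ^ 2)⁻¹)
    (h337B' : ∀ μ ν x, ‖c • covDstar T U ν (A ν) (T μ x)‖ ≤ α₁ * (g.len (blk x) ^ 2)⁻¹)
    (hρ : ∀ μ x, ‖((U μ x : 𝔸ˣ) : 𝔸)‖ ≤ ρ ∧ ‖(((U μ x)⁻¹ : 𝔸ˣ) : 𝔸)‖ ≤ ρ)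
    (hd₀F : ∀ μ x, g.dist (blk x) (blk (T μ x)) ≤ d₀) (hd₀B : ∀ ν x, g.dist (blk x) (blk ((T ν).symm x)) ≤ d₀)
    (hd₀FB : ∀ μ ν x, g.dist (blk x) (blk ((T ν).symm (T μ x))) ≤ d₀) :
    HasL2Majorant (g := toB6 g Rr H) (fun q : (κ × S) × ι => blk q.1.2) (conj b (zeroLetter₂ T U c A))
      (fun y y' => (2 * (2 * ρ ^ 2 + ρ ^ 6) * Fintype.card κ * M₂ * (∑ i, ‖b i‖) *
          Real.sqrt (((Fintype.card κ * (1 + 2 * Fintype.card κ + 2 * Fintype.card κ ^ 2)) * Fintype.card ι : ℕ) : ℝ) *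
          Real.exp (δ * d₀)) * α₁ * (g.len y ^ 2)⁻¹ * Real.exp (-(δ * g.dist y y'))) := by
  have hc0 : ∀ y : g.Site, 0 ≤ 2 * (2 * ρ ^ 2 + ρ ^ 6) * Fintype.card κ * α₁ * (g.len y ^ 2)⁻¹ := fun y => by positivity
  refine hasL2Majorant_mono (g := toB6 g Rr H) _
    (hasL2Majorant_conj_of_local (Rr := Rr) (H := H) b (fun p : κ × S => blk p.2)
      (fun p q => (∃ μ, q.2 = T μ p.2) ∨ (∃ μ ν, q.2 = (T ν).symm (T μ p.2)) ∨ ∃ ν, q.2 = (T ν).symm p.2)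
      (fun y => 2 * (2 * ρ ^ 2 + ρ ^ 6) * Fintype.card κ * α₁ * (g.len y ^ 2)⁻¹) d₀ δ M₂ _ hc0 hδ hM₂ hrepr ?_
      (mult_bond_of_shapes T _ fun p q h => ?_) (zeroLetter₂ T U c A) ?_)
    fun y y' => le_of_eq (by ring)
  · rintro p q (⟨μ, h⟩ | ⟨μ, ν, h⟩ | ⟨ν, h⟩)
    · rw [h]; exact hd₀F μ p.2
    · rw [h]; exact hd₀FB μ ν p.2
    · rw [h]; exact hd₀B ν p.2
  · rcases h with ⟨μ, h⟩ | ⟨μ, ν, h⟩ | ⟨ν, h⟩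
    · exact Or.inr (Or.inl ⟨μ, h⟩)
    · exact Or.inr (Or.inr (Or.inr (Or.inr ⟨μ, ν, h⟩)))
    · exact Or.inr (Or.inr (Or.inl ⟨ν, h⟩))
  · intro F p B hB
    rw [zeroLetter₂_apply]
    have hterm : ∀ ν, ‖(I : ℂ) • ad (c • covD T U p.1 (A ν) p.2) (tauF T U p.1 (fun z => F (ν, z)) p.2)
        + (I : ℂ) • ad (c • tauF T U p.1 (covDstar T U ν (A ν)) p.2) (tauF T U p.1 (tauB T U ν (fun w => F (ν, w))) p.2)
        - (I : ℂ) • ad (c • covDstar T U ν (A ν) p.2) (tauB T U ν (fun w => F (ν, w)) p.2)‖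
        ≤ 2 * (2 * ρ ^ 2 + ρ ^ 6) * (α₁ * (g.len (blk p.2) ^ 2)⁻¹) * B := by
      intro ν
      have hτF : ‖tauF T U p.1 (fun z => F (ν, z)) p.2‖ ≤ ρ ^ 2 * B := by
        rw [tauF_apply]
        refine (norm_R_le_sq _ (hρ p.1 _).1 (hρ p.1 _).2 _).trans ?_
        exact mul_le_mul_of_nonneg_left (hB (ν, T p.1 p.2) (Or.inl ⟨p.1, rfl⟩)) (sq_nonneg _)
      have hτB : ‖tauB T U ν (fun w => F (ν, w)) p.2‖ ≤ ρ ^ 2 * B := by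
        rw [tauB_apply]
        refine (norm_Rinv_le_sq _ (hρ ν _).1 (hρ ν _).2 _).trans ?_
        exact mul_le_mul_of_nonneg_left (hB (ν, (T ν).symm p.2) (Or.inr (Or.inr ⟨ν, rfl⟩))) (sq_nonneg _)
      have hτFB : ‖tauF T U p.1 (tauB T U ν (fun w => F (ν, w))) p.2‖ ≤ ρ ^ 2 * (ρ ^ 2 * B) := by
        rw [tauF_apply]
        refine (norm_R_le_sq _ (hρ p.1 _).1 (hρ p.1 _).2 _).trans (mul_le_mul_of_nonneg_left ?_ (sq_nonneg _))
        rw [tauB_apply]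
        refine (norm_Rinv_le_sq _ (hρ ν _).1 (hρ ν _).2 _).trans ?_
        exact mul_le_mul_of_nonneg_left (hB (ν, (T ν).symm (T p.1 p.2)) (Or.inr (Or.inl ⟨p.1, ν, rfl⟩))) (sq_nonneg _)
      have hcoef : ‖c • tauF T U p.1 (covDstar T U ν (A ν)) p.2‖ ≤ ρ ^ 2 * (α₁ * (g.len (blk p.2) ^ 2)⁻¹) := by
        rw [tauF_apply, ← R_smul]
        exact (norm_R_le_sq _ (hρ p.1 _).1 (hρ p.1 _).2 _).trans
          (mul_le_mul_of_nonneg_left (h337B' p.1 ν p.2) (sq_nonneg _))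
      have h5 : ‖(I : ℂ) • ad (c • covD T U p.1 (A ν) p.2) (tauF T U p.1 (fun z => F (ν, z)) p.2)‖
          ≤ 2 * (α₁ * (g.len (blk p.2) ^ 2)⁻¹) * (ρ ^ 2 * B) := norm_I_ad_le (h337F p.1 ν p.2) hτF
      have h6 : ‖(I : ℂ) • ad (c • tauF T U p.1 (covDstar T U ν (A ν)) p.2)
            (tauF T U p.1 (tauB T U ν (fun w => F (ν, w))) p.2)‖
          ≤ 2 * (ρ ^ 2 * (α₁ * (g.len (blk p.2) ^ 2)⁻¹)) * (ρ ^ 2 * (ρ ^ 2 * B)) := norm_I_ad_le hcoef hτFB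
      have h7 : ‖(I : ℂ) • ad (c • covDstar T U ν (A ν) p.2) (tauB T U ν (fun w => F (ν, w)) p.2)‖
          ≤ 2 * (α₁ * (g.len (blk p.2) ^ 2)⁻¹) * (ρ ^ 2 * B) := norm_I_ad_le (h337B ν p.2) hτB
      calc _ ≤ ‖(I : ℂ) • ad (c • covD T U p.1 (A ν) p.2) (tauF T U p.1 (fun z => F (ν, z)) p.2)
              + (I : ℂ) • ad (c • tauF T U p.1 (covDstar T U ν (A ν)) p.2)
                  (tauF T U p.1 (tauB T U ν (fun w => F (ν, w))) p.2)‖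
            + ‖(I : ℂ) • ad (c • covDstar T U ν (A ν) p.2) (tauB T U ν (fun w => F (ν, w)) p.2)‖ := norm_sub_le _ _
        _ ≤ (‖(I : ℂ) • ad (c • covD T U p.1 (A ν) p.2) (tauF T U p.1 (fun z => F (ν, z)) p.2)‖
              + ‖(I : ℂ) • ad (c • tauF T U p.1 (covDstar T U ν (A ν)) p.2)
                  (tauF T U p.1 (tauB T U ν (fun w => F (ν, w))) p.2)‖)
            + ‖(I : ℂ) • ad (c • covDstar T U ν (A ν) p.2) (tauB T U ν (fun w => F (ν, w)) p.2)‖ :=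
          add_le_add (norm_add_le _ _) le_rfl
        _ ≤ (2 * (α₁ * (g.len (blk p.2) ^ 2)⁻¹) * (ρ ^ 2 * B)
              + 2 * (ρ ^ 2 * (α₁ * (g.len (blk p.2) ^ 2)⁻¹)) * (ρ ^ 2 * (ρ ^ 2 * B)))
            + 2 * (α₁ * (g.len (blk p.2) ^ 2)⁻¹) * (ρ ^ 2 * B) := add_le_add (add_le_add h5 h6) h7
        _ = 2 * (2 * ρ ^ 2 + ρ ^ 6) * (α₁ * (g.len (blk p.2) ^ 2)⁻¹) * B := by ring
    refine (norm_sum_le _ _).trans ?_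
    calc ∑ ν, ‖(I : ℂ) • ad (c • covD T U p.1 (A ν) p.2) (tauF T U p.1 (fun z => F (ν, z)) p.2)
            + (I : ℂ) • ad (c • tauF T U p.1 (covDstar T U ν (A ν)) p.2) (tauF T U p.1 (tauB T U ν (fun w => F (ν, w))) p.2)
            - (I : ℂ) • ad (c • covDstar T U ν (A ν) p.2) (tauB T U ν (fun w => F (ν, w)) p.2)‖
          ≤ ∑ _ν : κ, 2 * (2 * ρ ^ 2 + ρ ^ 6) * (α₁ * (g.len (blk p.2) ^ 2)⁻¹) * B :=
          Finset.sum_le_sum fun ν _ => hterm ν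
      _ = 2 * (2 * ρ ^ 2 + ρ ^ 6) * Fintype.card κ * α₁ * (g.len (blk p.2) ^ 2)⁻¹ * B := by
          rw [Finset.sum_const, Finset.card_univ, nsmul_eq_mul]; ring

omit [CompleteSpace 𝔸] T U in
/-- **`hV1` FOR THE FORWARD COEFFICIENT LETTER OF (3.75), IN ℓ²** (twin of `B9Eq375GradLetters.hasMajorant_mixLetterF₂`; stencil `{x}`):
`conj b (mixLetterF₂ A k₀) ≺₂ 2d·M₂(Σ‖b_i‖)√(N#ι)·e^{δd₀}·α₁(Lʲη)⁻¹·e^{−δd}`.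
[cite: Balaban1985BackgroundPropagators, (3.37) p.396 + (3.75) p.405 + (3.73) p.405; Balaban1984PropagatorsII, Prop. 2.6 (2.140) p.247; derivation ours] -/
theorem hasL2Majorant_mixLetterF₂ (blk : S → g.Site) (A : κ → S → 𝔸) (d₀ δ M₂ α₁ : ℝ)
    (hα₁ : 0 ≤ α₁) (hδ : 0 ≤ δ) (hM₂ : 0 ≤ M₂) (hrepr : ∀ (v : 𝔸) (i : ι), |b.repr v i| ≤ M₂ * ‖v‖)
    (hlen : ∀ y : g.Site, 0 < g.len y) (hA : ∀ k x, ‖A k x‖ ≤ α₁ * (g.len (blk x))⁻¹)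
    (hd₀0 : ∀ y : g.Site, g.dist y y ≤ d₀) (k₀ : κ) :
    HasL2Majorant (g := toB6 g Rr H) (fun q : (κ × S) × ι => blk q.1.2) (conj b (mixLetterF₂ A k₀))
      (fun y y' => (2 * Fintype.card κ * M₂ * (∑ i, ‖b i‖) *
          Real.sqrt (((Fintype.card κ * (1 + 2 * Fintype.card κ + 2 * Fintype.card κ ^ 2)) * Fintype.card ι : ℕ) : ℝ) *
          Real.exp (δ * d₀)) * α₁ * (g.len y)⁻¹ * Real.exp (-(δ * g.dist y y'))) := by
  have hc0 : ∀ y : g.Site, 0 ≤ 2 * Fintype.card κ * α₁ * (g.len y)⁻¹ := fun y => by have := hlen y; positivity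
  refine hasL2Majorant_mono (g := toB6 g Rr H) _
    (hasL2Majorant_conj_of_local (Rr := Rr) (H := H) b (fun p : κ × S => blk p.2) (fun p q => q.2 = p.2)
      (fun y => 2 * Fintype.card κ * α₁ * (g.len y)⁻¹) d₀ δ M₂ _ hc0 hδ hM₂ hrepr (fun p q h => by rw [h]; exact hd₀0 _)
      (mult_bond_of_shapes (fun _ : κ => Equiv.refl S) _ fun p q h => Or.inl h) (mixLetterF₂ A k₀) ?_)
    fun y y' => le_of_eq (by ring)
  intro G p B hB
  have hB0 : 0 ≤ B := (norm_nonneg _).trans (hB p rfl)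
  rw [mixLetterF₂_apply]
  have hsum : ‖∑ ν, (I : ℂ) • ad (A ν p.2) (G (ν, p.2))‖ ≤ Fintype.card κ * (2 * (α₁ * (g.len (blk p.2))⁻¹) * B) := by
    refine (norm_sum_le _ _).trans ?_
    rw [← Finset.card_univ, ← nsmul_eq_mul, ← Finset.sum_const]
    exact Finset.sum_le_sum fun ν _ => norm_I_ad_le (hA ν p.2) (hB (ν, p.2) rfl)
  split_ifs with h
  · rw [one_smul]
    refine hsum.trans (le_of_eq ?_)
    ring
  · rw [zero_smul, norm_zero]
    exact mul_nonneg (hc0 _) hB0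

omit [CompleteSpace 𝔸] in
/-- ★ **`hV1` FOR EVERY COEFFICIENT LETTER `V¹_k` OF THE BRACKET OF (3.75), IN ℓ²** (twin of `B9Eq375GradLetters.hasMajorant_V1Letter₂`; `k ∈ κ ⊕ κ`):
`conj b (V1Letter₂ A k) ≺₂ 2(1+2ρ²)(d+1)·M₂(Σ‖b_i‖)√(N#ι)·e^{δd₀}·α₁(Lʲη)⁻¹e^{−δd}`.
[cite: Balaban1985BackgroundPropagators, (3.37) p.396 + (3.75) p.405 + (3.73) p.405; Balaban1984PropagatorsII, Prop. 2.6 (2.140) p.247; derivation ours] -/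
theorem hasL2Majorant_V1Letter₂ (blk : S → g.Site) (A : κ → S → 𝔸) (ρ d₀ δ M₂ α₁ : ℝ)
    (hα₁ : 0 ≤ α₁) (hδ : 0 ≤ δ) (hM₂ : 0 ≤ M₂) (hrepr : ∀ (v : 𝔸) (i : ι), |b.repr v i| ≤ M₂ * ‖v‖)
    (hlen : ∀ y : g.Site, 0 < g.len y)
    (hA : ∀ k x, ‖A k x‖ ≤ α₁ * (g.len (blk x))⁻¹) (hAτ : ∀ μ k x, ‖tauF T U μ (A k) x‖ ≤ α₁ * (g.len (blk x))⁻¹)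
    (hρ : ∀ μ x, ‖((U μ x : 𝔸ˣ) : 𝔸)‖ ≤ ρ ∧ ‖(((U μ x)⁻¹ : 𝔸ˣ) : 𝔸)‖ ≤ ρ)
    (hd₀F : ∀ μ x, g.dist (blk x) (blk (T μ x)) ≤ d₀) (hd₀0 : ∀ y : g.Site, g.dist y y ≤ d₀) (k : κ ⊕ κ) :
    HasL2Majorant (g := toB6 g Rr H) (fun q : (κ × S) × ι => blk q.1.2) (conj b (V1Letter₂ T U A k))
      (fun y y' => (2 * (1 + 2 * ρ ^ 2) * (Fintype.card κ + 1) * M₂ * (∑ i, ‖b i‖) *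
          Real.sqrt (((Fintype.card κ * (1 + 2 * Fintype.card κ + 2 * Fintype.card κ ^ 2)) * Fintype.card ι : ℕ) : ℝ) *
          Real.exp (δ * d₀)) * α₁ * (g.len y)⁻¹ * Real.exp (-(δ * g.dist y y'))) := by
  have hw : ∀ y y' : g.Site, 0 ≤ M₂ * (∑ i, ‖b i‖) *
      Real.sqrt (((Fintype.card κ * (1 + 2 * Fintype.card κ + 2 * Fintype.card κ ^ 2)) * Fintype.card ι : ℕ) : ℝ) *
      Real.exp (δ * d₀) * α₁ * (g.len y)⁻¹ * Real.exp (-(δ * g.dist y y')) := fun y y' => by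
    have := hlen y; have : 0 ≤ ∑ i, ‖b i‖ := Finset.sum_nonneg fun i _ => norm_nonneg _; positivity
  have hκ : (0 : ℝ) ≤ Fintype.card κ := Nat.cast_nonneg _
  rcases k with k₀ | k₀
  · rw [V1Letter₂_inl]
    refine hasL2Majorant_mono (g := toB6 g Rr H) _
      (hasL2Majorant_mixLetterF₂ (Rr := Rr) (H := H) b blk A d₀ δ M₂ α₁ hα₁ hδ hM₂ hrepr hlen hA hd₀0 k₀) fun y y' => ?_
    nlinarith [hw y y', mul_nonneg hκ (hw y y'), mul_nonneg (sq_nonneg ρ) (hw y y'),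
      mul_nonneg (mul_nonneg (sq_nonneg ρ) hκ) (hw y y')]
  · rw [V1Letter₂_inr]
    refine hasL2Majorant_mono (g := toB6 g Rr H) _
      (hasL2Majorant_mixLetterB₂ (Rr := Rr) (H := H) b T U blk A ρ d₀ δ M₂ α₁ hα₁ hδ hM₂ hrepr hlen hA hAτ hρ hd₀F hd₀0 k₀)
      fun y y' => ?_
    nlinarith [hw y y', mul_nonneg hκ (hw y y'), mul_nonneg (sq_nonneg ρ) (hw y y'),
      mul_nonneg (mul_nonneg (sq_nonneg ρ) hκ) (hw y y')]

end V2

/-! ## §3  The remainders `F₁`, `F₂` of (3.72), the zeroth-order part of `V₁`, and the curvature third `Δ′(U′U) − Δ′(U)`, in block-ℓ² form -/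

section Rem

variable {𝔸 : Type*} [NormedRing 𝔸] [NormedAlgebra ℂ 𝔸] [CompleteSpace 𝔸] {ι : Type} [Fintype ι] [DecidableEq ι]
variable (b : Module.Basis ι ℝ 𝔸) {S : Type} [Fintype S] [DecidableEq S] {κ : Type} [Fintype κ] [LinearOrder κ]
variable (T : κ → Equiv.Perm S) (U : κ → S → 𝔸ˣ)
variable {g : B9.Geometry} [Fintype g.Site] {Rr : ℝ} {H : Prop}

omit [NormedAlgebra ℂ 𝔸] [CompleteSpace 𝔸] [Fintype ι] [DecidableEq ι] [Fintype S] [DecidableEq S] [Fintype κ]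
  [LinearOrder κ] [Fintype g.Site] b T U in
/-- `‖(η⁻¹)²·X‖ = (η²)⁻¹‖X‖` for `η > 0` (plumbing, as in `B9Eq372RemLetters`). [folklore] -/
private theorem norm_invsq_smul [NormedAlgebra ℂ 𝔸] {η : ℝ} (hη : 0 < η) (X : 𝔸) :
    ‖(((η : ℂ)⁻¹) ^ 2) • X‖ = (η ^ 2)⁻¹ * ‖X‖ := by
  rw [norm_smul, norm_pow, norm_inv, Complex.norm_real, Real.norm_eq_abs, abs_of_pos hη, inv_pow]

omit [NormedAlgebra ℂ 𝔸] [CompleteSpace 𝔸] [Fintype ι] [DecidableEq ι] [Fintype S] [DecidableEq S] [Fintype κ]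
  [LinearOrder κ] [Fintype g.Site] b T U in
/-- THE ARITHMETIC OF (3.72) IN TRUE UNITS (verbatim from `B9Eq372RemLetters`, private there): `η⁻²X ≦ m′kρ⁸·growth(ρ²/4)·a²·B`.
[cite: Balaban1985BackgroundPropagators, (3.72) p.405 + (3.37) p.396] -/
private theorem remainder_bound {η ρ a B k m m' X : ℝ} (hη : 0 < η) (ha : 0 ≤ a) (hk : 0 ≤ k) (hB : 0 ≤ B)
    (hm : m ≤ m') (hm' : 0 ≤ m') (hsmall : η * a ≤ 1 / 4)
    (hX : X ≤ m * (k * ρ ^ 4 * (η * ρ ^ 2 * a) ^ 2 * Real.exp (2 * (η * ρ ^ 2 * a))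
          * (3 + 2 * (η * ρ ^ 2 * a) + (η * ρ ^ 2 * a) ^ 2 * Real.exp (2 * (η * ρ ^ 2 * a))) * B)) :
    (η ^ 2)⁻¹ * X ≤ m' * k * ρ ^ 8 * growth (ρ ^ 2 / 4) * a ^ 2 * B := by
  have hη0 : η ≠ 0 := hη.ne'
  have ht0 : 0 ≤ η * ρ ^ 2 * a := by positivity
  have ht1 : η * ρ ^ 2 * a ≤ ρ ^ 2 / 4 := by nlinarith [sq_nonneg ρ]
  have hg : Real.exp (2 * (η * ρ ^ 2 * a)) * (3 + 2 * (η * ρ ^ 2 * a) + (η * ρ ^ 2 * a) ^ 2 * Real.exp (2 * (η * ρ ^ 2 * a)))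
      ≤ growth (ρ ^ 2 / 4) := B9Eq372RemLetters.growth_mono ht0 ht1
  have h0 : 0 ≤ k * ρ ^ 4 * (η * ρ ^ 2 * a) ^ 2 * Real.exp (2 * (η * ρ ^ 2 * a))
      * (3 + 2 * (η * ρ ^ 2 * a) + (η * ρ ^ 2 * a) ^ 2 * Real.exp (2 * (η * ρ ^ 2 * a))) * B := by positivity
  have h1 := hX.trans (mul_le_mul_of_nonneg_right hm h0)
  have hsq : (η ^ 2)⁻¹ * (η * ρ ^ 2 * a) ^ 2 = ρ ^ 4 * a ^ 2 := by field_simp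
  have hc : 0 ≤ m' * k * ρ ^ 8 * a ^ 2 * B := by positivity
  calc (η ^ 2)⁻¹ * X
      ≤ (η ^ 2)⁻¹ * (m' * (k * ρ ^ 4 * (η * ρ ^ 2 * a) ^ 2 * Real.exp (2 * (η * ρ ^ 2 * a))
          * (3 + 2 * (η * ρ ^ 2 * a) + (η * ρ ^ 2 * a) ^ 2 * Real.exp (2 * (η * ρ ^ 2 * a))) * B)) :=
        mul_le_mul_of_nonneg_left h1 (by positivity)
    _ = m' * k * ρ ^ 4 * ((η ^ 2)⁻¹ * (η * ρ ^ 2 * a) ^ 2) * (Real.exp (2 * (η * ρ ^ 2 * a))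
          * (3 + 2 * (η * ρ ^ 2 * a) + (η * ρ ^ 2 * a) ^ 2 * Real.exp (2 * (η * ρ ^ 2 * a)))) * B := by ring
    _ = (m' * k * ρ ^ 8 * a ^ 2 * B) * (Real.exp (2 * (η * ρ ^ 2 * a))
          * (3 + 2 * (η * ρ ^ 2 * a) + (η * ρ ^ 2 * a) ^ 2 * Real.exp (2 * (η * ρ ^ 2 * a)))) := by rw [hsq]; ring
    _ ≤ (m' * k * ρ ^ 8 * a ^ 2 * B) * growth (ρ ^ 2 / 4) := mul_le_mul_of_nonneg_left hg hc
    _ = m' * k * ρ ^ 8 * growth (ρ ^ 2 / 4) * a ^ 2 * B := by ring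

/-- **(3.72) FOR `F_{1,k}(A)` AS A ZEROTH-ORDER BLOCK-ℓ² MAJORANT** (twin of `B9Eq372RemLetters.hasMajorant_F₁Letter`; the plaquette-star stencil `st(b)`,
pointwise core `B9Eq372Locality.norm_F₁op_le_st`): `conj b (F₁Letter η A) ≺₂ (8d·ρ⁸·growth(ρ²/4)·α₁·M₂(Σ‖b_i‖)√(N#ι)e^{δd₀})·α₁·(Lʲη)⁻²·e^{−δd}`.
[cite: Balaban1985BackgroundPropagators, (3.72) p.405 + (3.37) p.396; Balaban1984PropagatorsII, Prop. 2.6 (2.140) p.247; derivation ours] -/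
theorem hasL2Majorant_F₁Letter (blk : S → g.Site) {η : ℝ} (hη : 0 < η) (A : κ → S → 𝔸) (ρ d₀ δ M₂ α₁ : ℝ)
    (hα₁ : 0 ≤ α₁) (hδ : 0 ≤ δ) (hM₂ : 0 ≤ M₂) (hrepr : ∀ (v : 𝔸) (i : ι), |b.repr v i| ≤ M₂ * ‖v‖)
    (hlen : ∀ y : g.Site, 0 < g.len y) (hsmall : ∀ y : g.Site, η * (α₁ * (g.len y)⁻¹) ≤ 1 / 4) (hρ1 : 1 ≤ ρ)
    (hρ : ∀ μ x, ‖((U μ x : 𝔸ˣ) : 𝔸)‖ ≤ ρ ∧ ‖(((U μ x)⁻¹ : 𝔸ˣ) : 𝔸)‖ ≤ ρ)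
    (hAst : ∀ μ x k z, (k, z) ∈ stBonds T μ x → ‖A k z‖ ≤ α₁ * (g.len (blk x))⁻¹)
    (hd₀st : ∀ μ x (q : κ × S), q ∈ stBonds T μ x → g.dist (blk x) (blk q.2) ≤ d₀)
    (hd₀0 : ∀ y : g.Site, g.dist y y ≤ d₀) :
    HasL2Majorant (g := toB6 g Rr H) (fun q : (κ × S) × ι => blk q.1.2) (conj b (F₁Letter T U η A))
      (fun y y' => (8 * Fintype.card κ * ρ ^ 8 * growth (ρ ^ 2 / 4) * α₁ * M₂ * (∑ i, ‖b i‖) *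
          Real.sqrt (((Fintype.card κ * (1 + 2 * Fintype.card κ + 2 * Fintype.card κ ^ 2)) * Fintype.card ι : ℕ) : ℝ) *
          Real.exp (δ * d₀)) * α₁ * (g.len y ^ 2)⁻¹ * Real.exp (-(δ * g.dist y y'))) := by
  have hρ0 : 0 ≤ ρ := zero_le_one.trans hρ1
  have hG : 0 ≤ growth (ρ ^ 2 / 4) := growth_nonneg (by positivity)
  have hc0 : ∀ y : g.Site, 0 ≤ 8 * Fintype.card κ * ρ ^ 8 * growth (ρ ^ 2 / 4) * α₁ * α₁ * (g.len y ^ 2)⁻¹ := fun y => by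
    positivity
  refine hasL2Majorant_mono (g := toB6 g Rr H) _
    (hasL2Majorant_conj_of_local (Rr := Rr) (H := H) b (fun p : κ × S => blk p.2) (fun p q => q = p ∨ q ∈ stBonds T p.1 p.2)
      (fun y => 8 * Fintype.card κ * ρ ^ 8 * growth (ρ ^ 2 / 4) * α₁ * α₁ * (g.len y ^ 2)⁻¹) d₀ δ M₂ _ hc0 hδ hM₂ hrepr
      ?_ (mult_bond_of_shapes T _ fun p q h => ?_) (F₁Letter T U η A) ?_)
    fun y y' => le_of_eq (by ring)
  · rintro p q (rfl | h)
    · exact hd₀0 _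
    · exact hd₀st p.1 p.2 q h
  · rcases h with rfl | h
    · exact Or.inl rfl
    · exact stBonds_shape T h
  · intro F p B hB
    have hB0 : 0 ≤ B := (norm_nonneg _).trans (hB p (Or.inl rfl))
    have hl : 0 < g.len (blk p.2) := hlen _
    have ha : 0 ≤ α₁ * (g.len (blk p.2))⁻¹ := by positivity
    have hκ : ((Fintype.card κ : ℝ) - 1) ≤ Fintype.card κ := by linarith
    have h372 := norm_F₁op_le_st T U hη.le hρ1 (fun k z => (hρ k z).1) (fun k z => (hρ k z).2) A (fun k z => F (k, z))
      (μ := p.1) (x := p.2) (a := α₁ * (g.len (blk p.2))⁻¹) (a' := B) (fun k z h => hAst p.1 p.2 k z h)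
      (fun k z h => hB (k, z) (Or.inr h))
    rw [F₁Letter_apply, norm_invsq_smul hη]
    calc (η ^ 2)⁻¹ * ‖B9Eq371Composition.F₁op T U η A (fun k z => F (k, z)) p.1 p.2‖
        ≤ Fintype.card κ * 8 * ρ ^ 8 * growth (ρ ^ 2 / 4) * (α₁ * (g.len (blk p.2))⁻¹) ^ 2 * B :=
          remainder_bound hη ha (by norm_num) hB0 hκ (Nat.cast_nonneg _) (hsmall _) h372
      _ = 8 * Fintype.card κ * ρ ^ 8 * growth (ρ ^ 2 / 4) * α₁ * α₁ * (g.len (blk p.2) ^ 2)⁻¹ * B := by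
          rw [mul_pow, inv_pow]; ring

/-- **(3.72) FOR `F_{2,k}(A)` AS A ZEROTH-ORDER BLOCK-ℓ² MAJORANT** (twin of `B9Eq372RemLetters.hasMajorant_F₂Letter`; the (3.75)-stencil, pointwise core
`B9Eq375Locality.norm_F₂op_le_loc`): `conj b (F₂Letter η A) ≺₂ (4d·ρ⁸·growth(ρ²/4)·α₁·M₂(Σ‖b_i‖)√(N#ι)e^{δd₀})·α₁·(Lʲη)⁻²·e^{−δd}`.
[cite: Balaban1985BackgroundPropagators, (3.75) + (3.72) p.405 + (3.37) p.396; Balaban1984PropagatorsII, Prop. 2.6 (2.140) p.247; derivation ours] -/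
theorem hasL2Majorant_F₂Letter (blk : S → g.Site) {η : ℝ} (hη : 0 < η) (A : κ → S → 𝔸) (ρ d₀ δ M₂ α₁ : ℝ)
    (hα₁ : 0 ≤ α₁) (hδ : 0 ≤ δ) (hM₂ : 0 ≤ M₂) (hrepr : ∀ (v : 𝔸) (i : ι), |b.repr v i| ≤ M₂ * ‖v‖)
    (hlen : ∀ y : g.Site, 0 < g.len y) (hsmall : ∀ y : g.Site, η * (α₁ * (g.len y)⁻¹) ≤ 1 / 4) (hρ1 : 1 ≤ ρ)
    (hρ : ∀ μ x, ‖((U μ x : 𝔸ˣ) : 𝔸)‖ ≤ ρ ∧ ‖(((U μ x)⁻¹ : 𝔸ˣ) : 𝔸)‖ ≤ ρ)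
    (hAloc : ∀ μ x k z, (k, z) ∈ locBondsA T μ x → ‖A k z‖ ≤ α₁ * (g.len (blk x))⁻¹)
    (hd₀loc : ∀ μ x (q : κ × S), q ∈ locBondsA' T μ x → g.dist (blk x) (blk q.2) ≤ d₀)
    (hd₀0 : ∀ y : g.Site, g.dist y y ≤ d₀) :
    HasL2Majorant (g := toB6 g Rr H) (fun q : (κ × S) × ι => blk q.1.2) (conj b (F₂Letter T U η A))
      (fun y y' => (4 * Fintype.card κ * ρ ^ 8 * growth (ρ ^ 2 / 4) * α₁ * M₂ * (∑ i, ‖b i‖) *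
          Real.sqrt (((Fintype.card κ * (1 + 2 * Fintype.card κ + 2 * Fintype.card κ ^ 2)) * Fintype.card ι : ℕ) : ℝ) *
          Real.exp (δ * d₀)) * α₁ * (g.len y ^ 2)⁻¹ * Real.exp (-(δ * g.dist y y'))) := by
  have hρ0 : 0 ≤ ρ := zero_le_one.trans hρ1
  have hG : 0 ≤ growth (ρ ^ 2 / 4) := growth_nonneg (by positivity)
  have hc0 : ∀ y : g.Site, 0 ≤ 4 * Fintype.card κ * ρ ^ 8 * growth (ρ ^ 2 / 4) * α₁ * α₁ * (g.len y ^ 2)⁻¹ := fun y => by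
    positivity
  refine hasL2Majorant_mono (g := toB6 g Rr H) _
    (hasL2Majorant_conj_of_local (Rr := Rr) (H := H) b (fun p : κ × S => blk p.2) (fun p q => q = p ∨ q ∈ locBondsA' T p.1 p.2)
      (fun y => 4 * Fintype.card κ * ρ ^ 8 * growth (ρ ^ 2 / 4) * α₁ * α₁ * (g.len y ^ 2)⁻¹) d₀ δ M₂ _ hc0 hδ hM₂ hrepr
      ?_ (mult_bond_of_shapes T _ fun p q h => ?_) (F₂Letter T U η A) ?_)
    fun y y' => le_of_eq (by ring)
  · rintro p q (rfl | h)
    · exact hd₀0 _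
    · exact hd₀loc p.1 p.2 q h
  · rcases h with rfl | h
    · exact Or.inl rfl
    · exact locBondsA'_shape T h
  · intro F p B hB
    have hB0 : 0 ≤ B := (norm_nonneg _).trans (hB p (Or.inl rfl))
    have hl : 0 < g.len (blk p.2) := hlen _
    have ha : 0 ≤ α₁ * (g.len (blk p.2))⁻¹ := by positivity
    have h372 := norm_F₂op_le_loc T U hη.le hρ1 ha hB0 (fun k z => (hρ k z).1) (fun k z => (hρ k z).2) A
      (fun k z => F (k, z)) p.1 p.2 (fun k z h => hAloc p.1 p.2 k z h) (fun k z h => hB (k, z) (Or.inr h))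
    rw [F₂Letter_apply, norm_invsq_smul hη]
    calc (η ^ 2)⁻¹ * ‖B9Eq375Composition.F₂op T U η A (fun k z => F (k, z)) p.1 p.2‖
        ≤ Fintype.card κ * 4 * ρ ^ 8 * growth (ρ ^ 2 / 4) * (α₁ * (g.len (blk p.2))⁻¹) ^ 2 * B :=
          remainder_bound hη ha (by norm_num) hB0 le_rfl (Nat.cast_nonneg _) (hsmall _) h372
      _ = 4 * Fintype.card κ * ρ ^ 8 * growth (ρ ^ 2 / 4) * α₁ * α₁ * (g.len (blk p.2) ^ 2)⁻¹ * B := by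
          rw [mul_pow, inv_pow]; ring

/-- **THE ZEROTH-ORDER PART OF THE FULL `V₁(A)` IN ℓ²** (twin of `B9Eq372RemLetters.hasMajorant_V₁Op_zero`): `conj b (zeroLetter η⁻¹ A + F₁Letter η A) ≺₂
(c_br + c_F)·√(N#ι)·α₁(Lʲη)⁻²e^{−δd}`. [cite: Balaban1985BackgroundPropagators, (3.72)–(3.73) p.405 + (3.82) p.407; Balaban1984PropagatorsII, Prop. 2.6 (2.140) p.247; derivation ours] -/
theorem hasL2Majorant_V₁Op_zero (blk : S → g.Site) {η : ℝ} (hη : 0 < η) (A : κ → S → 𝔸) (ρ d₀ δ M₂ α₁ : ℝ)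
    (hα₁ : 0 ≤ α₁) (hδ : 0 ≤ δ) (hM₂ : 0 ≤ M₂) (hrepr : ∀ (v : 𝔸) (i : ι), |b.repr v i| ≤ M₂ * ‖v‖)
    (hlen : ∀ y : g.Site, 0 < g.len y) (hsmall : ∀ y : g.Site, η * (α₁ * (g.len y)⁻¹) ≤ 1 / 4) (hρ1 : 1 ≤ ρ)
    (hρ : ∀ μ x, ‖((U μ x : 𝔸ˣ) : 𝔸)‖ ≤ ρ ∧ ‖(((U μ x)⁻¹ : 𝔸ˣ) : 𝔸)‖ ≤ ρ)
    (h337 : ∀ ν k x, ‖((η : ℂ)⁻¹) • covDstar T U ν (A k) x‖ ≤ α₁ * (g.len (blk x) ^ 2)⁻¹)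
    (hAst : ∀ μ x k z, (k, z) ∈ stBonds T μ x → ‖A k z‖ ≤ α₁ * (g.len (blk x))⁻¹)
    (hd₀ : ∀ μ x, g.dist (blk x) (blk ((T μ).symm x)) ≤ d₀)
    (hd₀st : ∀ μ x (q : κ × S), q ∈ stBonds T μ x → g.dist (blk x) (blk q.2) ≤ d₀)
    (hd₀0 : ∀ y : g.Site, g.dist y y ≤ d₀) :
    HasL2Majorant (g := toB6 g Rr H) (fun q : (κ × S) × ι => blk q.1.2)
      (conj b (zeroLetter T U ((η : ℂ)⁻¹) A + F₁Letter T U η A))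
      (fun y y' => ((2 * (1 + ρ ^ 2) * Fintype.card κ + 8 * Fintype.card κ * ρ ^ 8 * growth (ρ ^ 2 / 4) * α₁) * M₂ *
        (∑ i, ‖b i‖) * Real.sqrt (((Fintype.card κ * (1 + 2 * Fintype.card κ + 2 * Fintype.card κ ^ 2)) * Fintype.card ι : ℕ) : ℝ) *
        Real.exp (δ * d₀)) * α₁ * (g.len y ^ 2)⁻¹ * Real.exp (-(δ * g.dist y y'))) := by
  rw [conj_add]
  refine hasL2Majorant_mono (g := toB6 g Rr H) _
    (hasL2Majorant_add (g := toB6 g Rr H) _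
      (hasL2Majorant_zeroLetter (Rr := Rr) (H := H) b T U blk ((η : ℂ)⁻¹) A ρ d₀ δ M₂ α₁ hα₁ hδ hM₂ hrepr h337 hρ hd₀ hd₀0)
      (hasL2Majorant_F₁Letter (Rr := Rr) (H := H) b T U blk hη A ρ d₀ δ M₂ α₁ hα₁ hδ hM₂ hrepr hlen hsmall hρ1 hρ hAst hd₀st
        hd₀0))
    fun y y' => le_of_eq (by ring)

/-- **THE CURVATURE THIRD `Δ′(U′U) − Δ′(U)` OF `V₃` AS A ZEROTH-ORDER BLOCK-ℓ² MAJORANT** (twin of `B9Eq382V3Letters.hasMajorant_dPrimeDiff`; the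
plaquette-star stencil, pointwise core `B9Eq382V3Letters.eq369_diff_local`): `conj b (dPrimeLetter (U′U) − dPrimeLetter U) ≺₂ ((d−1)·k_Δ(α₁,C₀)·
M₂(Σ‖b_i‖)√(N#ι)e^{δd₀})·α₁·(Lʲη)⁻²·e^{−δd}`. [cite: Balaban1985BackgroundPropagators, p.404 after (3.69) + (3.82) p.407; Balaban1984PropagatorsII, Prop. 2.6 (2.140) p.247; derivation ours] -/
theorem hasL2Majorant_dPrimeDiff (blk : S → g.Site) (hη : 0 < g.eta) (hL : 1 ≤ g.L) (A : κ → S → 𝔸) (C₀ d₀ δ M₂ α₁ : ℝ)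
    (hα₁ : 0 ≤ α₁) (hC₀ : 0 ≤ C₀) (hδ : 0 ≤ δ) (hM₂ : 0 ≤ M₂) (hrepr : ∀ (v : 𝔸) (i : ι), |b.repr v i| ≤ M₂ * ‖v‖)
    (hU1 : ∀ m z, ‖((U m z : 𝔸ˣ) : 𝔸)‖ ≤ 1 ∧ ‖(((U m z)⁻¹ : 𝔸ˣ) : 𝔸)‖ ≤ 1)
    (hAst : ∀ μ x m z, (m, z) ∈ stBonds T μ x → ‖A m z‖ ≤ α₁ * (g.len (blk x))⁻¹)
    (hdAst : ∀ μ x m n y, Through T μ x m n y →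
      ‖covD T U m (A n) y‖ ≤ g.eta * (α₁ * ((g.len (blk x))⁻¹) ^ 2) ∧
        ‖covD T U n (A m) y‖ ≤ g.eta * (α₁ * ((g.len (blk x))⁻¹) ^ 2))
    (h35 : ∀ μ x m n y, Through T μ x m n y → ‖(plaqU T U m n y : 𝔸) - 1‖ ≤ C₀ * ((g.L ^ g.scale (blk x))⁻¹) ^ 2)
    (hd₀st : ∀ μ x (q : κ × S), q ∈ stBonds T μ x → g.dist (blk x) (blk q.2) ≤ d₀)
    (hd₀0 : ∀ y : g.Site, g.dist y y ≤ d₀) :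
    HasL2Majorant (g := toB6 g Rr H) (fun q : (κ × S) × ι => blk q.1.2)
      (conj b (dPrimeLetter T (prodCfg U g.eta A) g.eta - dPrimeLetter T U g.eta))
      (fun y y' => (((Fintype.card κ - 1 : ℕ) : ℝ) * kΔ α₁ C₀ * M₂ * (∑ i, ‖b i‖) *
          Real.sqrt (((Fintype.card κ * (1 + 2 * Fintype.card κ + 2 * Fintype.card κ ^ 2)) * Fintype.card ι : ℕ) : ℝ) *
          Real.exp (δ * d₀)) * α₁ * (g.len y ^ 2)⁻¹ * Real.exp (-(δ * g.dist y y'))) := by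
  have hk : 0 ≤ kΔ α₁ C₀ := kΔ_nonneg hα₁ hC₀
  have hc0 : ∀ y : g.Site, 0 ≤ ((Fintype.card κ - 1 : ℕ) : ℝ) * α₁ * kΔ α₁ C₀ * (g.len y ^ 2)⁻¹ := fun y => by positivity
  refine hasL2Majorant_mono (g := toB6 g Rr H) _
    (hasL2Majorant_conj_of_local (Rr := Rr) (H := H) b (fun p : κ × S => blk p.2) (fun p q => q = p ∨ q ∈ stBonds T p.1 p.2)
      (fun y => ((Fintype.card κ - 1 : ℕ) : ℝ) * α₁ * kΔ α₁ C₀ * (g.len y ^ 2)⁻¹) d₀ δ M₂ _ hc0 hδ hM₂ hrepr ?_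
      (mult_bond_of_shapes T _ fun p q h => ?_) _ ?_)
    fun y y' => le_of_eq (by ring)
  · rintro p q (rfl | h)
    · exact hd₀0 _
    · exact hd₀st p.1 p.2 q h
  · rcases h with rfl | h
    · exact Or.inl rfl
    · exact stBonds_shape T h
  · intro F p B hB
    -- the A′-letters on the plaquettes through `b` are letters on `stBonds(b)` (as in the sup twin)
    have hF : ∀ m n y, Through T p.1 p.2 m n y →
        ‖F (m, y)‖ ≤ B ∧ ‖F (n, T m y)‖ ≤ B ∧ ‖F (m, T n y)‖ ≤ B ∧ ‖F (n, y)‖ ≤ B := by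
      intro m n y h
      have hm : ∀ q, q ∈ pBonds T m n y → q ∈ stBonds T p.1 p.2 :=
        fun q hq => B9Eq372Locality.mem_stBonds_iff.mpr ⟨m, n, y, h, hq⟩
      exact ⟨hB _ (Or.inr (hm _ (by simp [pBonds]))), hB _ (Or.inr (hm _ (by simp [pBonds]))),
        hB _ (Or.inr (hm _ (by simp [pBonds]))), hB _ (Or.inr (hm _ (by simp [pBonds])))⟩
    have h369 := eq369_diff_local T U (L := g.L) (j := g.scale (blk p.2)) hη hL hα₁ (fun m z => (hU1 m z).1)
      (fun m z => (hU1 m z).2) A (fun k z => F (k, z)) p.1 p.2 (hAst p.1 p.2) (hdAst p.1 p.2) hF (h35 p.1 p.2)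
    rw [LinearMap.sub_apply, Pi.sub_apply, dPrimeLetter_apply, dPrimeLetter_apply]
    refine h369.trans (le_of_eq ?_)
    show _ = ((Fintype.card κ - 1 : ℕ) : ℝ) * α₁ * kΔ α₁ C₀ * (g.len (blk p.2) ^ 2)⁻¹ * B
    simp only [B9.Geometry.len]
    ring

end Rem

/-! ## §4  `V₃(A)` of (3.82): the `hV1` ∕ `hV0` inputs of the ℓ² device along `conj_V₃Op_eq_gradForm` -/

section V3

variable {𝔸 : Type*} [NormedRing 𝔸] [NormedAlgebra ℂ 𝔸] [CompleteSpace 𝔸] {ι : Type} [Fintype ι] [DecidableEq ι]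
variable (b : Module.Basis ι ℝ 𝔸) {S : Type} [Fintype S] [DecidableEq S] {κ : Type} [Fintype κ] [LinearOrder κ]
variable (T : κ → Equiv.Perm S) (U : κ → S → 𝔸ˣ)
variable {g : B9.Geometry} [Fintype g.Site] {Rr : ℝ} {H : Prop}

omit [CompleteSpace 𝔸] in
/-- ★★ **`hV1` FOR THE CONCRETE `V₃` IN ℓ²** (twin of `B9Eq382V3Letters.hasMajorant_V₃_one`): the first-order coefficient letters
`V1_k = conj b (V1Letter A k) + conj b (V1Letter₂ A k)` (transport size `ρ = 1`) have `V1_k ≺₂ 14(d+1)·M₂(Σ‖b_i‖)√(N#ι)e^{δd₀}·α₁(Lʲη)⁻¹·e^{−δd}`.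
[cite: Balaban1985BackgroundPropagators, (3.73) p.405 + (3.82) p.407; Balaban1984PropagatorsII, Prop. 2.6 (2.140) p.247; derivation ours] -/
theorem hasL2Majorant_V₃_one (blk : S → g.Site) (A : κ → S → 𝔸) (d₀ δ M₂ α₁ : ℝ)
    (hα₁ : 0 ≤ α₁) (hδ : 0 ≤ δ) (hM₂ : 0 ≤ M₂) (hrepr : ∀ (v : 𝔸) (i : ι), |b.repr v i| ≤ M₂ * ‖v‖)
    (hlen : ∀ y : g.Site, 0 < g.len y)
    (hA : ∀ k x, ‖A k x‖ ≤ α₁ * (g.len (blk x))⁻¹) (hAτB : ∀ ν k x, ‖tauB T U ν (A k) x‖ ≤ α₁ * (g.len (blk x))⁻¹)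
    (hAτF : ∀ μ k x, ‖tauF T U μ (A k) x‖ ≤ α₁ * (g.len (blk x))⁻¹)
    (hU1 : ∀ μ x, ‖((U μ x : 𝔸ˣ) : 𝔸)‖ ≤ 1 ∧ ‖(((U μ x)⁻¹ : 𝔸ˣ) : 𝔸)‖ ≤ 1)
    (hd₀B : ∀ μ x, g.dist (blk x) (blk ((T μ).symm x)) ≤ d₀) (hd₀F : ∀ μ x, g.dist (blk x) (blk (T μ x)) ≤ d₀)
    (hd₀0 : ∀ y : g.Site, g.dist y y ≤ d₀) (k : κ ⊕ κ) :
    HasL2Majorant (g := toB6 g Rr H) (fun q : (κ × S) × ι => blk q.1.2)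
      (conj b (V1Letter T U A k) + conj b (V1Letter₂ T U A k))
      (fun y y' => (14 * (Fintype.card κ + 1) * M₂ * (∑ i, ‖b i‖) *
          Real.sqrt (((Fintype.card κ * (1 + 2 * Fintype.card κ + 2 * Fintype.card κ ^ 2)) * Fintype.card ι : ℕ) : ℝ) *
          Real.exp (δ * d₀)) * α₁ * (g.len y)⁻¹ * Real.exp (-(δ * g.dist y y'))) := by
  refine hasL2Majorant_mono (g := toB6 g Rr H) _
    (hasL2Majorant_add (g := toB6 g Rr H) _
      (hasL2Majorant_V1Letter (Rr := Rr) (H := H) b T U blk A 1 d₀ δ M₂ α₁ hα₁ hδ hM₂ hrepr hlen hA hAτB hU1 hd₀B hd₀0 k)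
      (hasL2Majorant_V1Letter₂ (Rr := Rr) (H := H) b T U blk A 1 d₀ δ M₂ α₁ hα₁ hδ hM₂ hrepr hlen hA hAτF hU1 hd₀F hd₀0 k))
    fun y y' => le_of_eq (by ring)

/-- ★★ **`hV0` FOR THE CONCRETE `V₃` IN ℓ²** (twin of `B9Eq382V3Letters.hasMajorant_V₃_zero`): the zeroth-order part of `conj_V₃Op_eq_gradForm`,
`V0 = conj b (zeroLetter η⁻¹ A + F₁Letter η A) − conj b (Δ′(U′U) − Δ′(U)) + conj b (zeroLetter₂ η⁻¹ A + F₂Letter η A)`, has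
`V0 ≺₂ c⁰_V(d, α₁, C₀)·M₂(Σ‖b_i‖)√(N#ι)e^{δd₀}·α₁(Lʲη)⁻²·e^{−δd}` at `η = g.eta`, for a group-valued background, under (3.37) read blockwise on the
stencils, (3.35) on the plaquettes through the output bond, `η·α₁(Lʲη)⁻¹ ≦ 1/4`, and the stencil geometry — the SAME constant `cV0` as the sup twin.
[cite: Balaban1985BackgroundPropagators, (3.73) p.405 + (3.82) p.407 + p.404; Balaban1984PropagatorsII, Prop. 2.6 (2.140) p.247; derivation ours] -/
theorem hasL2Majorant_V₃_zero (blk : S → g.Site) (hη : 0 < g.eta) (hL : 1 ≤ g.L) (A : κ → S → 𝔸) (C₀ d₀ δ M₂ α₁ : ℝ)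
    (hα₁ : 0 ≤ α₁) (hC₀ : 0 ≤ C₀) (hδ : 0 ≤ δ) (hM₂ : 0 ≤ M₂) (hrepr : ∀ (v : 𝔸) (i : ι), |b.repr v i| ≤ M₂ * ‖v‖)
    (hlen : ∀ y : g.Site, 0 < g.len y) (hsmall : ∀ y : g.Site, g.eta * (α₁ * (g.len y)⁻¹) ≤ 1 / 4)
    (hU1 : ∀ m z, ‖((U m z : 𝔸ˣ) : 𝔸)‖ ≤ 1 ∧ ‖(((U m z)⁻¹ : 𝔸ˣ) : 𝔸)‖ ≤ 1)
    -- (3.37) for the exponent field, blockwise, in the shapes the letters read it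
    (h337B : ∀ ν k x, ‖((g.eta : ℂ)⁻¹) • covDstar T U ν (A k) x‖ ≤ α₁ * (g.len (blk x) ^ 2)⁻¹)
    (h337F : ∀ μ ν x, ‖((g.eta : ℂ)⁻¹) • covD T U μ (A ν) x‖ ≤ α₁ * (g.len (blk x) ^ 2)⁻¹)
    (h337B' : ∀ μ ν x, ‖((g.eta : ℂ)⁻¹) • covDstar T U ν (A ν) (T μ x)‖ ≤ α₁ * (g.len (blk x) ^ 2)⁻¹)
    (hAst : ∀ μ x m z, (m, z) ∈ stBonds T μ x → ‖A m z‖ ≤ α₁ * (g.len (blk x))⁻¹)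
    (hAloc : ∀ μ x m z, (m, z) ∈ locBondsA T μ x → ‖A m z‖ ≤ α₁ * (g.len (blk x))⁻¹)
    (hdAst : ∀ μ x m n y, Through T μ x m n y →
      ‖covD T U m (A n) y‖ ≤ g.eta * (α₁ * ((g.len (blk x))⁻¹) ^ 2) ∧
        ‖covD T U n (A m) y‖ ≤ g.eta * (α₁ * ((g.len (blk x))⁻¹) ^ 2))
    (h35 : ∀ μ x m n y, Through T μ x m n y → ‖(plaqU T U m n y : 𝔸) - 1‖ ≤ C₀ * ((g.L ^ g.scale (blk x))⁻¹) ^ 2)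
    -- stencil geometry
    (hd₀B : ∀ μ x, g.dist (blk x) (blk ((T μ).symm x)) ≤ d₀) (hd₀F : ∀ μ x, g.dist (blk x) (blk (T μ x)) ≤ d₀)
    (hd₀FB : ∀ μ ν x, g.dist (blk x) (blk ((T ν).symm (T μ x))) ≤ d₀)
    (hd₀st : ∀ μ x (q : κ × S), q ∈ stBonds T μ x → g.dist (blk x) (blk q.2) ≤ d₀)
    (hd₀loc : ∀ μ x (q : κ × S), q ∈ locBondsA' T μ x → g.dist (blk x) (blk q.2) ≤ d₀)
    (hd₀0 : ∀ y : g.Site, g.dist y y ≤ d₀) :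
    HasL2Majorant (g := toB6 g Rr H) (fun q : (κ × S) × ι => blk q.1.2)
      (conj b (zeroLetter T U ((g.eta : ℂ)⁻¹) A + F₁Letter T U g.eta A)
        - conj b (dPrimeLetter T (prodCfg U g.eta A) g.eta - dPrimeLetter T U g.eta)
        + conj b (zeroLetter₂ T U ((g.eta : ℂ)⁻¹) A + F₂Letter T U g.eta A))
      (fun y y' => (cV0 (Fintype.card κ) α₁ C₀ * M₂ * (∑ i, ‖b i‖) *
          Real.sqrt (((Fintype.card κ * (1 + 2 * Fintype.card κ + 2 * Fintype.card κ ^ 2)) * Fintype.card ι : ℕ) : ℝ) *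
          Real.exp (δ * d₀)) * α₁ * (g.len y ^ 2)⁻¹ * Real.exp (-(δ * g.dist y y'))) := by
  have h1 := hasL2Majorant_V₁Op_zero (Rr := Rr) (H := H) b T U blk hη A 1 d₀ δ M₂ α₁ hα₁ hδ hM₂ hrepr hlen hsmall le_rfl hU1
    h337B hAst hd₀B hd₀st hd₀0
  have hΔ := hasL2Majorant_dPrimeDiff (Rr := Rr) (H := H) b T U blk hη hL A C₀ d₀ δ M₂ α₁ hα₁ hC₀ hδ hM₂ hrepr hU1 hAst hdAst h35
    hd₀st hd₀0
  have h2 := hasL2Majorant_zeroLetter₂ (Rr := Rr) (H := H) b T U blk ((g.eta : ℂ)⁻¹) A 1 d₀ δ M₂ α₁ hα₁ hδ hM₂ hrepr h337F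
    (fun ν x => h337B ν ν x) h337B' hU1 hd₀F hd₀B hd₀FB
  have h3 := hasL2Majorant_F₂Letter (Rr := Rr) (H := H) b T U blk hη A 1 d₀ δ M₂ α₁ hα₁ hδ hM₂ hrepr hlen hsmall le_rfl hU1 hAloc
    hd₀loc hd₀0
  rw [conj_add b (zeroLetter₂ T U _ A)]
  refine hasL2Majorant_mono (g := toB6 g Rr H) _
    (hasL2Majorant_add (g := toB6 g Rr H) _ (hasL2Majorant_sub (Rr := Rr) (H := H) _ h1 hΔ)
      (hasL2Majorant_add (g := toB6 g Rr H) _ h2 h3))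
    fun y y' => le_of_eq ?_
  simp only [cV0, one_pow]
  ring

end V3

end Literature.MathematicalPhysics.QuantumFieldTheory.Balaban1983to89.B9Ineq373L2Letters
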